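import Summits.FinalStateConjecture.FinalStateConjecture.Theses.SwallowTheDatum
import Literature.Geometry.Lorentzian.ModelData
import Literature.Geometry.Lorentzian.ModelDataProofs
import Literature.Geometry.Lorentzian.ModelDataCompletenessProofs
import Literature.Geometry.Lorentzian.LeviCivitaProofs
import Literature.Geometry.Lorentzian.PseudoRiemannianMetricProofs
import Literature.Geometry.Lorentzian.KerrDataProofs
import Literature.Geometry.Lorentzian.KerrSchildCoord
import Literature.Geometry.Lorentzian.KerrDataSchwarzschildExtrinsic
import Literature.Geometry.Lorentzian.TrivialDataAdmissible
import Literature.Geometry.Lorentzian.LocalIsometryScalarCurvature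
import Literature.Geometry.Lorentzian.KerrDataSchwarzschildMetric
import Literature.Geometry.Lorentzian.CoordFamilyRegularity
import Literature.Geometry.Lorentzian.ChartMetricCoord
import Literature.Geometry.Lorentzian.IsometryProofs

/-!
# Disproof of `ParametricKerrBurial` — findings (cdisprove, crux stmt-FinalStateConjecture-10052,
# route SwallowTheDatum; refuter-cdisprove-stmt-FinalStateConjecture-10052-0 (cycle 1, 2026-08-15),
# refuter-cdisprove-stmt-FinalStateConjecture-10052-g2-0 (cycle 2, 2026-08-16),
# refuter-cdisprove-stmt-FinalStateConjecture-10052-g3-0 (cycle 3, 2026-08-16))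

CYCLE 3 (2026-08-16) — NEW, all `sorry`-free (§8 below):
* §8 GENERAL-SPIN TEETH. The zero-spin restriction of §4–§7 is lifted ON THE ROTATION AXIS, where
  the Kerr–Schild data of ANY spin are explicit: at `(t; 0, 0, u)`, `r = u`, `ℓ ≡ dt* + dz`,
  `H = Mu/(u² + a²)`, `∂_z g = 2H′ ℓ₀⊗ℓ₀`, `∂_{t*} g = 0`; the future unit normal is forced for
  every spin (`eq_normalRepA`), and the typed `secondFundamentalForm` of every shield evaluates at
  the axis test point `y₀ = (0, 0, 3M)` of the unbent zone to the CLOSED FORM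
  `k(dφ e_z, dφ e_z) = −2H′(3M)(1 + H)/√(1 + 2H) > 0` (`k_pullback_axisPt`, `axisTooth_pos`;
  `H′(3M) = M(a² − 9M²)/(9M² + a²)² < 0` for `|a| < M`). Hence, for the FULL typed predicate:
  `exists_k_ne_zero_of_isKerrShieldedWith` (every shield forces `k ≢ 0`),
  `not_isKerrShielded_of_isTimeSymmetric` (no time-symmetric datum — flat, Schwarzschild /
  Brill–Lindquist / Misner slices — is Kerr-shielded, any spin), and the LOAD-BEARING ANALYSIS of
  the guard `c ≠ 0`: `parametricKerrBurial_false_without_ne_zero` — the crux with `∀ c ≠ 0`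
  replaced by `∀ c` is FALSE at `d = trivialData` (so any proof must genuinely move the family
  off `d`; constant / eventually-constant-at-`d` families are dead for every spin:
  `not_forall_admissible_isKerrShielded`).
* §9 ALL-SPIN SWELL-OR-RECEDE: with the `h`-clause at the same axis point
  (`h(dφ e_z, dφ e_z) = 1 + 2H ≤ 5/3`) and the spin-uniform size of the tooth
  (`k(dφ e_z, dφ e_z) ≥ 4/(25M)`, `axisTooth_ge`), the joint continuity of BOTH sections along a
  smooth family (`contDiffAt_kRepr_of_isSmoothDataFamily`) refutes the CONFINED BOUNDED-MASS
  strengthening for the full predicate and every time-symmetric centre: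
  `not_confined_burial_of_mass_le` — along `cₙ → 0` the members of a smooth family through a
  time-symmetric datum on `ℝ³` (flat data, Brill waves) cannot carry shields of ANY spin with
  `Mₙ ≤ μ` whose near-junction zones stay in one compact set (supersedes §7's zero-spin version).
* LANDED as tree modules (importable by ideators / planners / provers):
  `Theorems/ParametricKerrBurial/Negative/GeneralSpinAxis.lean` (p77499: axis closed forms, normal
  uniqueness for any spin), `…/Negative/GeneralSpinShieldTeeth.lean` (p79236: `k_pullback_axisPt`,
  `exists_k_ne_zero_of_spinShield`, `not_kerrShielded_of_isTimeSymmetric`,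
  `parametricKerrBurial_false_without_ne_zero` against the crux's verbatim text),
  `…/Negative/GeneralSpinBurialLimit.lean` (part V, §9; proposed after IV). All def-free: heights
  enter through `hT0 : ∀ r ≤ 4M, T r = 0` (the crux's lambda satisfies it:
  `crux_spin_height_eq_zero`), the normal through the local notation `νKS[M, a]`.
* Cycle-3 audit (no kill): DR rates of the bent end re-derived (`k ~ aM r⁻³ = o₁(r⁻²)`,
  `h − (1 + 2M/r)δ = O₂(r⁻²)` on Boyer–Lindquist slices; the AF chart of `admissibleVacuumData`
  is existential, so the `O(a/r)` azimuthal twist of Kerr–Schild Cartesian coordinates is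
  immaterial); negatives index / barrier catalogue unchanged; picked line
  `receding-annulus-universal-collar` read: its stubs honour §2/§5/§8 (the collar's time-symmetric
  annulus is disjoint from the shield, `IsKerrShieldedAway 2`; no member `F c`, `c ≠ 0`, is
  time-symmetric), so §8 constrains but does not kill the line.

CYCLE 2 (2026-08-16) — all `sorry`-free (§6–§7 below):
* §6 INTRINSIC TEETH: `scalarCurvature_shield_unbent` — on the unbent zone `‖y‖ < 4M` of ANY
  zero-spin shield, `R(h)(φ y) = 8M²/(‖y‖²(‖y‖+2M)²)` (naturality of `R` under the local
  isometry `φ`, `PseudoRiemannianMetric.scalarCurvature_comap`, + Cook's closed form; no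
  `Kerr.SliceFacts` needed); hence `exists_scalarCurvature_pos_of_isKerrShieldedWith_zero`
  (`R = 8/(225M²)` at `φ(0,0,3M)`) and `not_isKerrShieldedWith_zero_of_scalarCurvature_nonpos`:
  no datum with `R(h) ≤ 0` (all scalar-flat data: time-symmetric vacuum data, `|k|² = (tr k)²`)
  carries a zero-spin shield — the intrinsic counterpart of §5.
* §7 THE `c → 0` LIMIT: `contDiffAt_repr_of_isSmoothDataFamily` (the typed `IsSmoothDataFamily`
  unpacked: representatives are jointly `C^∞` in `(c, y)`), `continuous_scalarCurvature_family`
  (`(z,t) ↦ R(h_{t e₁})(z)` is continuous — Ricci-flow brick `IsMetricFamilyOn.contDiffOn_scalAt_family`),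
  and the CONFINED STRENGTHENING REFUTED: `not_confined_zeroSpin_burial_of_radius_le` /
  `not_confined_zeroSpin_burial` — no smooth family through flat data has, along `cₙ → 0`,
  zero-spin shields with bounded junction radii `r₁(n) ≤ ρ` (a fortiori: bounded masses,
  `r₁ < 2M`) whose near-junction zones `φₙ({‖y‖ < 4Mₙ})` stay in one compact set (core:
  `false_of_scal_ge_on_compact`; test point at Kerr–Schild radius `r₁ + min 1 ((2M−r₁)/2)` where
  `R ≥ 1/(2(r₁+1)²)`). I.e. the junction spheres of a burial family must SWELL (`r₁(n) → ∞`,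
  hence `Mₙ → ∞`) or RECEDE to infinity: the loophole lives exactly where the typed genericity has
  no topology (kill criterion (e) made quantitative). On paper the swelling-but-confined case dies
  too (round spheres of area `> 4π r₁²` inside a fixed compact), and unconfined bounded-mass witnesses exist in
  substance (translate one shielded datum to infinity at speed `e^{1/c²}` — jointly smooth at
  `c = 0` because every `c`-derivative of `μ/|x − x_c|` carries a factor `e^{-1/c²}`).
* Cycle-2 audit (no kill): curvature-sign conventions consistent (tree proves the KS-slice
  constraints with `k ≢ 0`); admissibility has no maximality clause; Hypersurface predicates leave
  no junk freedom (unit future normal forced); bent-slice spacelikeness re-derived and re-scanned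
  independently (`sup g⁻¹(n,n) = −1.1483` at `a = 0`, `r = 6.655M`; BL zone `≤ −1.0097`).
* Cycle-2 literature (Hintz arXiv:2210.13960 at page level): Thm 5.2 (2), p. 57 — the glued
  total family EQUALS the background near `X̃ ∖ ([0,1) × U°)` AND equals the rescaled small datum
  near `r̂ ≤ R̂₀` for ANY fixed `R̂₀` with `B(0,R̂₀) ⊃ K̂`: the gluing is localized to an annulus on
  both sides, so the interior `K̂°` (the arbitrary topology of the one-ended `X`) is glued back by
  hand — the worry "Hintz glues on `ℝ³ ∖ K̂`, not on a complete one-ended `X`" is void; the family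
  is polyhomogeneous in `ε` (smooth for `ε > 0`, p. 53), so `ε = e^{-1/c²}` plausibly gives joint
  smoothness at `c = 0`. Thm 6.2 (§6.2, p. 66) glues into EXACT Kerr only by tolerating
  constraint violations in `r < r_e − η` (inner boundary at `r_e − 2η`): NOT admissible — the
  route's complete vacuum cap with a KID-free pocket (items `KerrShieldedDataExist` + BCS05) is
  genuinely needed. Net: print supports the crux; no negative result found.

VERDICT SO FAR: **no kill.** The crux is an engineered `∀ X ∀ d ∈ 𝓓(X) ∃ F …` existence claim
whose every typed conjunct was checked satisfiable; it resists because (i) its only hypothesis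
`d ∈ 𝓓(X)` is restated in the conclusion, (ii) the typed genericity (`IsSmoothDataFamily` =
local joint smoothness on `ℝ¹ × X`) puts no topology on data, so far-field modifications receding
to infinity are invisible at `c = 0`, and (iii) the shielding predicate `S` is the print recipe
(Li–Mei exact-Kerr exterior + Hintz/Mao–Oh–Tao gluing into a KID-free pocket, rescaled), for
which no obstruction is known. What this file PROVES (all `sorry`-free, standard axioms):

* §0 `parametricKerrBurial_iff` (`Iff.rfl`): the crux is `∀ X, ∀ d ∈ 𝓓 X, BurialFamilyThrough X d`
  with `IsKerrShielded` / `IsKerrShieldedWith M a r₁` the shielding predicate isolated verbatim.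
* §1 ANTI-VACUITY OF THE HYPOTHESIS: flat `(ℝ³, δ, 0)` is admissible — tree theorem
  `trivialData_mem_admissibleVacuumData` (`TrivialDataAdmissible.lean`); the crux is NOT vacuously true.
* §2 LOAD-BEARING HYPOTHESIS: `parametricKerrBurial_false_without_admissible` — dropping
  `d ∈ 𝓓(X)` makes the crux false (witness `badData = (ℝ³, δ, δ)`: Hamiltonian constraint `= 6`).
* §3 COST: `exists_injective_shielded_family` — the crux implies an injective family of
  admissible Kerr-shielded data on `ℝ³`; the route's kill criterion (a) (typed `S ∧ admissible`
  unsatisfiable) therefore sinks this crux too. (At `d = trivialData` the crux is, in substance,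
  EQUIVALENT to one shielded admissible datum: rescale it about a regular point, `ε = e^{-1/c²}`.)
* §4 STRUCTURE (reusable by provers): `bentHeight_eq_zero` (`T ≡ 0` on `r ≤ 4M`),
  `bentHeight_scale` (`T_{cM,ca}(cr) = c T_{M,a}(r)`: the predicate is scale-invariant), junction
  inequalities (`0 < M`, `0 < r₁ < 2M`), and for ZERO SPIN on the unbent zone `‖y‖ < 4M`:
  `ψ = sliceEmbed`, `dψ = (0, ·)`, the future unit normal is FORCED (`nu_eq_sliceNormalRep`, on
  the tree's `Kerr.eq_sliceNormalRep` — LANDED from this seat, p69066 `KerrSliceNormalRigidity.lean`,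
  with `Kerr.secondFundamentalForm_eq_kRep_of_repr`), and `k_pullback_eq_kRep`: `(φ^*k)_y(v,w) = kRep M y v w` (Cook's closed form) — the first
  honest computation with the typed `secondFundamentalForm` inside a route predicate.
* §5 TEETH / STRENGTHENING REFUTED: `exists_k_ne_zero_of_isKerrShieldedWith_zero` — a
  Schwarzschild-shielded datum has `k ≢ 0`; hence `not_isKerrShieldedWith_zero_of_isTimeSymmetric`
  (no time-symmetric datum — flat, Brill–Lindquist, Misner — is Schwarzschild-shielded),
  `not_isKerrShieldedWith_zero_trivialData`, and `not_forall_admissible_isKerrShieldedWith_zero`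
  (the strengthening "the member `F 0 = d` is shielded too" / "constant families" is false).

NOT PROVED (near-misses / prose, see NOTES.md of the session):
* (cycle 3: the `a ≠ 0` teeth ARE now proved on the axis, §8; still open: the INTRINSIC `R > 0`
  tooth of §6 for `a ≠ 0`, which needs the curvature of the spinning Kerr–Schild slice);
* CHEAPEST FALSIFIER (1) of the route — spacelikeness of the hard-coded bent slice — PASSES:
  with the exact Kerr–Schild identities `ℓ⃗·∇r = 1`, `|∇r|² = (r²+a²)/Σ`, `2H = 2Mr/Σ`,
  `g⁻¹(n,n) = −1 + T′²|∇r|² − 2H(1+T′)²` has `sup_{[4M,8M]×θ} = −1.148 (a=0), −1.154 (a=.5M),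
  −1.166 (a=.9M), −1.170 (a→M)`, and `→ −1⁻` on the Boyer–Lindquist part (`compute/spacelike_scan.py`);
* PMT-RIGIDITY OBSTRUCTION (prose): a non-trivial datum can never be buried inside an EXACTLY
  FLAT collar (restrict to core+collar, extend flat: complete AF vacuum datum with `E_ADM = 0` ⇒
  Minkowskian); together with Hintz's no-KID hypothesis (exact Kerr / flat regions have KIDs on
  every open set; his §6.2 work-around VIOLATES the constraints inside the hole) this pins the
  construction to a dynamical KID-free pocket of a Li–Mei-type datum — the only live route, and
  the reason the crux is XL rather than false.
-/

noncomputable section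

set_option linter.dupNamespace false

namespace Summit.FinalStateConjecture.FinalStateConjecture.Cruxes.ParametricKerrBurial.Disproof

open Literature.Geometry.Lorentzian
open scoped Manifold ContDiff Topology InnerProductSpace
open Set Bundle Filter

-- instance search through nested operator types `E4 →L E4 →L E4 →L ℝ` (as in the tree files)
set_option maxSynthPendingDepth 3

/-! ## §0  The crux, unfolded: the shielding predicate and the conclusion at one datum -/

/-- `Kerr.Facts` is inhabited (all three fields are theorems in the tree), so the leading
binder `∀ [Kerr.Facts]` of the crux neither trivialises nor blocks it. [folklore] -/
instance kerrFacts : Kerr.Facts :=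
  ⟨Kerr.isConnected_region_holds, Kerr.contMDiff_bilin_holds, Kerr.contMDiff_timeVector_holds⟩

/-- The hard-coded bent height `T_{M,a}` of the crux (verbatim). -/
def bentHeight (M a : ℝ) : ℝ → ℝ := fun r : ℝ =>
  Real.smoothTransition (r / (4 * M) - 1) *
    (((M) / Real.sqrt ((M) ^ 2 - (a) ^ 2)) *
        (Kerr.rPlus M a * Real.log (r - Kerr.rPlus M a) -
          Kerr.rMinus M a * Real.log (r - Kerr.rMinus M a)) -
      ((M) / Real.sqrt ((M) ^ 2 - (a) ^ 2)) *
        (Kerr.rPlus M a * Real.log ((4 * M) - Kerr.rPlus M a) -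
          Kerr.rMinus M a * Real.log ((4 * M) - Kerr.rMinus M a)))

/-- The SHIELDING PREDICATE `S(D)` of the crux, isolated verbatim: outside a compact set the datum
`D` on `X` is the exact bent Kerr–Schild/Boyer–Lindquist slice `{r > r₁}`, `r₋ < r₁ < r₊`, of a
sub-extremal Kerr. -/
def IsKerrShielded [Kerr.Facts] (X : Type) [TopologicalSpace X] [ChartedSpace E3 X]
    [IsManifold (𝓡 3) ∞ X] (D : InitialDataSet (𝓡 3) X) : Prop :=
  ∃ (M a r₁ : ℝ) (hM : 0 ≤ M) (T : ℝ → ℝ) (φ : Kerr.slice a r₁ → X)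
    (ψ : Kerr.slice a r₁ → Kerr.region a r₁) (ν : NormalField 𝓘(ℝ, E4) ψ),
    |a| < M ∧ Kerr.rMinus M a < r₁ ∧ r₁ < Kerr.rPlus M a ∧ T = bentHeight M a ∧
    IsCompact (Set.range φ)ᶜ ∧ Topology.IsOpenEmbedding φ ∧
    ContMDiff 𝓘(ℝ, E3) (𝓡 3) ∞ φ ∧
    (∀ y : Kerr.slice a r₁, (ψ y : E4) =
      E4.ofTimeSpace (T (Kerr.radius a (E4.ofTimeSpace 0 (y : E3)))) (y : E3)) ∧
    (Kerr.smoothMetric M a r₁).IsSpacelikeImmersion 𝓘(ℝ, E3) ψ ∧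
    (Kerr.smoothMetric M a r₁).IsFutureUnitNormal 𝓘(ℝ, E3)
      ((Kerr.timeOrientation M a r₁ hM).ofLE le_top) ψ ν ∧
    (∀ y : Kerr.slice a r₁,
      pullbackBilin (I := 𝓡 3) (I' := 𝓘(ℝ, E3)) φ D.h.inner y =
        pullbackBilin (I := 𝓘(ℝ, E4)) (I' := 𝓘(ℝ, E3)) ψ (Kerr.smoothMetric M a r₁).val y) ∧
    (∀ [(Kerr.smoothMetric M a r₁).HasLeviCivita] (y : Kerr.slice a r₁),
      (pullbackBilin (I := 𝓡 3) (I' := 𝓘(ℝ, E3)) φ D.k y).toLinearMap₁₂ =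
        (Kerr.smoothMetric M a r₁).secondFundamentalForm 𝓘(ℝ, E3) ψ ν y)

/-- The shielding predicate with its parameters `(M, a, r₁)` exposed. -/
def IsKerrShieldedWith [Kerr.Facts] (M a r₁ : ℝ) (X : Type) [TopologicalSpace X]
    [ChartedSpace E3 X] [IsManifold (𝓡 3) ∞ X] (D : InitialDataSet (𝓡 3) X) : Prop :=
  ∃ (hM : 0 ≤ M) (T : ℝ → ℝ) (φ : Kerr.slice a r₁ → X)
    (ψ : Kerr.slice a r₁ → Kerr.region a r₁) (ν : NormalField 𝓘(ℝ, E4) ψ),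
    |a| < M ∧ Kerr.rMinus M a < r₁ ∧ r₁ < Kerr.rPlus M a ∧ T = bentHeight M a ∧
    IsCompact (Set.range φ)ᶜ ∧ Topology.IsOpenEmbedding φ ∧
    ContMDiff 𝓘(ℝ, E3) (𝓡 3) ∞ φ ∧
    (∀ y : Kerr.slice a r₁, (ψ y : E4) =
      E4.ofTimeSpace (T (Kerr.radius a (E4.ofTimeSpace 0 (y : E3)))) (y : E3)) ∧
    (Kerr.smoothMetric M a r₁).IsSpacelikeImmersion 𝓘(ℝ, E3) ψ ∧
    (Kerr.smoothMetric M a r₁).IsFutureUnitNormal 𝓘(ℝ, E3)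
      ((Kerr.timeOrientation M a r₁ hM).ofLE le_top) ψ ν ∧
    (∀ y : Kerr.slice a r₁,
      pullbackBilin (I := 𝓡 3) (I' := 𝓘(ℝ, E3)) φ D.h.inner y =
        pullbackBilin (I := 𝓘(ℝ, E4)) (I' := 𝓘(ℝ, E3)) ψ (Kerr.smoothMetric M a r₁).val y) ∧
    (∀ [(Kerr.smoothMetric M a r₁).HasLeviCivita] (y : Kerr.slice a r₁),
      (pullbackBilin (I := 𝓡 3) (I' := 𝓘(ℝ, E3)) φ D.k y).toLinearMap₁₂ =
        (Kerr.smoothMetric M a r₁).secondFundamentalForm 𝓘(ℝ, E3) ψ ν y)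

/-- `S(D) ↔ ∃ (M, a, r₁), S_{M,a,r₁}(D)` (definitional). -/
theorem isKerrShielded_iff [Kerr.Facts] {X : Type} [TopologicalSpace X] [ChartedSpace E3 X]
    [IsManifold (𝓡 3) ∞ X] {D : InitialDataSet (𝓡 3) X} :
    IsKerrShielded X D ↔ ∃ M a r₁, IsKerrShieldedWith M a r₁ X D :=
  Iff.rfl

/-- The CONCLUSION of the crux at one datum `d` on `X`: a smooth injective admissible family
through `d` whose `c ≠ 0` members are Kerr-shielded. -/
def BurialFamilyThrough [Kerr.Facts] (X : Type) [TopologicalSpace X] [ChartedSpace E3 X]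
    [IsManifold (𝓡 3) ∞ X] (d : InitialDataSet (𝓡 3) X) : Prop :=
  ∃ F : EuclideanSpace ℝ (Fin 1) → InitialDataSet (𝓡 3) X,
    InitialDataSet.IsSmoothDataFamily 1 F ∧ F 0 = d ∧ Function.Injective F ∧
    (∀ c, F c ∈ admissibleVacuumData X) ∧ ∀ c ≠ 0, IsKerrShielded X (F c)

/-- The crux IS `∀ X, ∀ d ∈ 𝓓(X), BurialFamilyThrough X d` (definitional unfolding). -/
theorem parametricKerrBurial_iff :
    Theses.SwallowTheDatum.ParametricKerrBurial ↔
      ∀ [Kerr.Facts] (X : Type) [TopologicalSpace X] [ChartedSpace E3 X]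
        [IsManifold (𝓡 3) ∞ X] [T2Space X] [SecondCountableTopology X] [ConnectedSpace X],
        ∀ d ∈ admissibleVacuumData X, BurialFamilyThrough X d :=
  Iff.rfl


/-! ## §1  Anti-vacuity of the HYPOTHESIS: the admissible class is inhabited (flat data on `ℝ³`)

The crux is not vacuously true: `trivialData = (ℝ³, δ, 0) ∈ admissibleVacuumData Minkowski.slice`.
This is now the tree theorem `Literature.Geometry.Lorentzian.trivialData_mem_admissibleVacuumData`
(`TrivialDataAdmissible.lean`, landed 2026-08-15T22:29Z in parallel with this seat's own proof,
which is therefore dropped here in favour of the tree's); we only record the instance. -/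

/-- The crux has a non-vacuous instance: `X = Minkowski.slice ≅ ℝ³`, `d = trivialData`. -/
example : trivialData ∈ admissibleVacuumData Minkowski.slice := trivialData_mem_admissibleVacuumData

/-! ## §2  Load-bearing analysis of the (only) hypothesis `d ∈ 𝓓(X)`

The conclusion RESTATES the hypothesis (`F 0 = d` and `∀ c, F c ∈ 𝓓`), so the hypothesis can be
dropped only if every datum on every `X` were admissible — which is false: the datum
`(ℝ³, δ, δ)` violates the Hamiltonian constraint (`R − |k|² + (tr k)² = 0 − 3 + 9 = 6`). -/

/-- The conclusion of the crux at `d` forces `d ∈ 𝓓(X)` (evaluate the family at `c = 0`). -/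
theorem mem_admissible_of_burialFamilyThrough [Kerr.Facts] {X : Type} [TopologicalSpace X]
    [ChartedSpace E3 X] [IsManifold (𝓡 3) ∞ X] {d : InitialDataSet (𝓡 3) X}
    (h : BurialFamilyThrough X d) : d ∈ admissibleVacuumData X := by
  obtain ⟨F, -, h0, -, hadm, -⟩ := h
  exact h0 ▸ hadm 0

/-- The crux with the admissibility hypothesis DROPPED. -/
def ParametricKerrBurialWithoutAdmissible : Prop :=
  ∀ [Kerr.Facts] (X : Type) [TopologicalSpace X] [ChartedSpace E3 X]
    [IsManifold (𝓡 3) ∞ X] [T2Space X] [SecondCountableTopology X] [ConnectedSpace X]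
    (d : InitialDataSet (𝓡 3) X), BurialFamilyThrough X d

/-- The non-admissible witness: `(ℝ³, δ, k = δ)` on the Minkowski slice. [folklore] -/
def badData : InitialDataSet 𝓘(ℝ, E3) Minkowski.slice where
  h := Minkowski.flatMetric
  k _ := (innerSL ℝ (E := E3) : E3 →L[ℝ] E3 →L[ℝ] ℝ)
  k_symm _ v w := real_inner_comm (F := E3) w v
  contMDiff_k := Minkowski.contMDiff_innerSL_slice

/-- `badData` has the flat metric of `trivialData` (by `rfl`). -/
theorem badData_metric : badData.metric = trivialData.metric := rfl

/-- `k = h` for `badData`: `kBilin = toBilinForm` of the metric (by `rfl`). -/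
theorem badData_kBilin (x : Minkowski.slice) :
    badData.kBilin x = badData.metric.toBilinForm x := rfl

/-- `tr_h k = 3` for `badData` (`g^{ij} g_{ij} = dim = 3`). [folklore] -/
theorem badData_traceK (x : Minkowski.slice) : badData.traceK x = 3 := by
  rw [InitialDataSet.traceK, badData_kBilin, PseudoRiemannianMetric.trace_toBilinForm_eq,
    finrank_euclideanSpace_fin]
  norm_num

/-- `|k|²_h = 3` for `badData` (`tr ((g⁻¹g)²) = tr id = 3`). [folklore] -/
theorem badData_normSqK (x : Minkowski.slice) : badData.normSqK x = 3 := by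
  rw [InitialDataSet.normSqK, badData_kBilin, PseudoRiemannianMetric.normSq]
  have hflip : (badData.metric.toBilinForm x).flip = badData.metric.toBilinForm x := by
    ext v w
    exact badData.metric.symm x w v
  rw [hflip, PseudoRiemannianMetric.sharp_comp_toBilinForm]
  show LinearMap.trace ℝ E3 (LinearMap.id ∘ₗ LinearMap.id) = 3
  rw [LinearMap.id_comp, LinearMap.trace_id, finrank_euclideanSpace_fin]
  norm_num

/-- The Hamiltonian constraint function of `badData` is `6 ≠ 0` everywhere. [folklore] -/
theorem badData_hamiltonianConstraintFn [badData.metric.HasLeviCivita] (x : Minkowski.slice) :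
    badData.hamiltonianConstraintFn x = 6 := by
  rw [InitialDataSet.hamiltonianConstraintFn, badData_traceK, badData_normSqK]
  haveI : trivialData.metric.HasLeviCivita := ‹badData.metric.HasLeviCivita›
  have h0 : badData.metric.scalarCurvature x = 0 := trivialData_scalarCurvature_eq_zero x
  rw [h0]
  norm_num

/-- `(ℝ³, δ, δ)` is NOT admissible (it violates the Hamiltonian constraint). [folklore] -/
theorem badData_not_mem_admissibleVacuumData :
    badData ∉ admissibleVacuumData Minkowski.slice := by
  intro h
  haveI : badData.metric.HasLeviCivita := PseudoRiemannianMetric.hasLeviCivita _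
  have hc := ((h.1).1 (Classical.arbitrary _)).1
  rw [badData_hamiltonianConstraintFn] at hc
  norm_num at hc

/-- **Any proof must use admissibility of `d`**: the crux with `d ∈ 𝓓(X)` dropped is FALSE
(witness `X = Minkowski.slice`, `d = (δ, δ)`). [folklore] -/
theorem parametricKerrBurial_false_without_admissible : ¬ ParametricKerrBurialWithoutAdmissible :=
  fun h ↦ badData_not_mem_admissibleVacuumData
    (mem_admissible_of_burialFamilyThrough (h Minkowski.slice badData))

/-! ## §3  What the crux COSTS: it implies anti-vacuity of the shielding predicate on `ℝ³`

Instantiating at flat data: the crux yields an injective family `c ↦ F c` (`c ≠ 0`) of ADMISSIBLE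
KERR-SHIELDED data on `Minkowski.slice ≅ ℝ³`. So kill criterion (a) of the route (the typed
shielding predicate `S ∧ admissible` unsatisfiable on `ℝ³`) sinks this crux as well; conversely
at `d = trivialData` the crux is EQUIVALENT in substance to the existence of one shielded
admissible datum (rescalings about a regular point give the family; see module docstring). -/

/-- `ParametricKerrBurial` ⇒ a Kerr-shielded admissible datum exists on `ℝ³`
(indeed uncountably many pairwise distinct ones, `exists_injective_shielded_family`). -/
theorem exists_shielded_admissible (h : Theses.SwallowTheDatum.ParametricKerrBurial) :
    ∃ D ∈ admissibleVacuumData Minkowski.slice, IsKerrShielded Minkowski.slice D := by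
  obtain ⟨F, -, -, -, hadm, hS⟩ :=
    (parametricKerrBurial_iff.mp h) Minkowski.slice trivialData trivialData_mem_admissibleVacuumData
  have h1 : (EuclideanSpace.single 0 1 : EuclideanSpace ℝ (Fin 1)) ≠ 0 := by
    intro h0
    have := congrArg (fun v : EuclideanSpace ℝ (Fin 1) ↦ v 0) h0
    simp at this
  exact ⟨F _, hadm _, hS _ h1⟩

/-- `ParametricKerrBurial` ⇒ an INJECTIVE family, indexed by `{c : ℝ¹ | c ≠ 0}`, of admissible
Kerr-shielded data on `ℝ³`. -/
theorem exists_injective_shielded_family (h : Theses.SwallowTheDatum.ParametricKerrBurial) :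
    ∃ F : EuclideanSpace ℝ (Fin 1) → InitialDataSet (𝓡 3) Minkowski.slice,
      Function.Injective F ∧ ∀ c ≠ 0, F c ∈ admissibleVacuumData Minkowski.slice ∧
        IsKerrShielded Minkowski.slice (F c) := by
  obtain ⟨F, -, -, hinj, hadm, hS⟩ :=
    (parametricKerrBurial_iff.mp h) Minkowski.slice trivialData trivialData_mem_admissibleVacuumData
  exact ⟨F, hinj, fun c hc ↦ ⟨hadm c, hS c hc⟩⟩

/-! ## §4  Structure of the shielding predicate (support lemmas the provers can reuse)

* `bentHeight_eq_zero`: the hard-coded height vanishes on `r ≤ 4M` — near the junction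
  `r₁ < r₊ ≤ 2M` the bent slice IS the Kerr–Schild slice `{t* = 0}` (and the `Real.log` junk
  below `r₊` is multiplied by `0`);
* `IsKerrShieldedWith.mass_pos` etc.: `|a| < M`, `r₋ < r₁ < r₊` force `0 < M`, `0 < r₁ < 2M`;
* zero spin, unbent zone `‖y‖ < 4M`: the graph `ψ` is `sliceEmbed` (`psi_eq_sliceEmbed`), its
  differential is `v ↦ (0, v)` (`mfderiv_psi`), the future unit normal is FORCED to be the
  Kerr–Schild slice normal (tree: `Kerr.eq_sliceNormalRep`; here `nu_eq_sliceNormalRep` — linear algebra with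
  `g(V, ·) = −dt*` and positivity of `g` on slice directions), and the second fundamental form of
  ANY such `(ψ, ν)` is the closed form `kRep` of `KerrDataSchwarzschildExtrinsic.lean`
  (tree: `Kerr.secondFundamentalForm_eq_kRep_of_repr`, `KerrSliceNormalRigidity.lean`, landed
  from this seat as p69066); hence
  `k_pullback_eq_kRep`: **`(φ^*k)_y = kRep M y` on the unbent zone of every zero-spin shield.** -/

/-- The hard-coded bent height vanishes for `r ≤ 4M` (`smoothTransition ≤ 0 ↦ 0`). -/
theorem bentHeight_eq_zero {M a r : ℝ} (hM : 0 < M) (hr : r ≤ 4 * M) : bentHeight M a r = 0 := by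
  unfold bentHeight
  have h4 : (0 : ℝ) < 4 * M := by positivity
  have : r / (4 * M) - 1 ≤ 0 := by
    rw [sub_nonpos, div_le_one h4]; exact hr
  rw [Real.smoothTransition.zero_of_nonpos this, zero_mul]

/-- A shield has positive mass: `|a| < M ⇒ 0 < M`. -/
theorem IsKerrShieldedWith.mass_pos [Kerr.Facts] {M a r₁ : ℝ} {X : Type} [TopologicalSpace X]
    [ChartedSpace E3 X] [IsManifold (𝓡 3) ∞ X] {D : InitialDataSet (𝓡 3) X}
    (h : IsKerrShieldedWith M a r₁ X D) : 0 < M := by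
  obtain ⟨-, -, -, -, -, haM, -⟩ := h
  exact (abs_nonneg a).trans_lt haM

/-- The junction radius of a shield is positive (`0 ≤ r₋ < r₁`). -/
theorem IsKerrShieldedWith.r₁_pos [Kerr.Facts] {M a r₁ : ℝ} {X : Type} [TopologicalSpace X]
    [ChartedSpace E3 X] [IsManifold (𝓡 3) ∞ X] {D : InitialDataSet (𝓡 3) X}
    (h : IsKerrShieldedWith M a r₁ X D) : 0 < r₁ := by
  obtain ⟨-, -, -, -, -, haM, hr₁, -⟩ := h
  exact (Kerr.IsSubextremal.rMinus_nonneg haM).trans_lt hr₁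

/-- The junction radius of a shield lies strictly inside `2M ≤ 4M`, so `bentHeight` vanishes
near the junction: `r₁ < r₊ = M + √(M² − a²) ≤ 2M`. -/
theorem IsKerrShieldedWith.r₁_lt_two_mul [Kerr.Facts] {M a r₁ : ℝ} {X : Type}
    [TopologicalSpace X] [ChartedSpace E3 X] [IsManifold (𝓡 3) ∞ X]
    {D : InitialDataSet (𝓡 3) X} (h : IsKerrShieldedWith M a r₁ X D) : r₁ < 2 * M := by
  obtain ⟨hM, -, -, -, -, haM, -, hr₁', -⟩ := h
  have hs : √(M ^ 2 - a ^ 2) ≤ M := by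
    rw [Real.sqrt_le_left hM]  -- √x ≤ M ↔ x ≤ M²  (for 0 ≤ M)
    nlinarith [sq_nonneg a]
  have : Kerr.rPlus M a ≤ 2 * M := by unfold Kerr.rPlus; linarith
  exact hr₁'.trans_le this

/-- `√((cM)² − (ca)²) = c √(M² − a²)` for `c > 0`. [folklore] -/
theorem sqrt_scale {c : ℝ} (hc : 0 < c) (M a : ℝ) :
    Real.sqrt ((c * M) ^ 2 - (c * a) ^ 2) = c * Real.sqrt (M ^ 2 - a ^ 2) := by
  rw [show (c * M) ^ 2 - (c * a) ^ 2 = c ^ 2 * (M ^ 2 - a ^ 2) by ring,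
    Real.sqrt_mul (by positivity), Real.sqrt_sq hc.le]

/-- The horizon radii are homogeneous of degree one: `r₊(cM, ca) = c r₊(M, a)`. [folklore] -/
theorem rPlus_scale {c : ℝ} (hc : 0 < c) (M a : ℝ) :
    Kerr.rPlus (c * M) (c * a) = c * Kerr.rPlus M a := by
  unfold Kerr.rPlus; rw [sqrt_scale hc]; ring

/-- `r₋(cM, ca) = c r₋(M, a)`. [folklore] -/
theorem rMinus_scale {c : ℝ} (hc : 0 < c) (M a : ℝ) :
    Kerr.rMinus (c * M) (c * a) = c * Kerr.rMinus M a := by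
  unfold Kerr.rMinus; rw [sqrt_scale hc]; ring

/-- **Scale covariance of the hard-coded bent height**: `T_{cM, ca}(c r) = c · T_{M,a}(r)` for
`c > 0`, `|a| < M` (the rescaling step `Kerr(M,a) ↦ Kerr(M/ε, a/ε)` of the intended proof is
consistent with the typed `T`; together with the degree-zero homogeneity of the Kerr–Schild
components `g_{cM,ca}(cx) = g_{M,a}(x)` this makes the shielding predicate scale-invariant). [folklore] -/
theorem bentHeight_scale {c M a : ℝ} (hc : 0 < c) (haM : |a| < M) (r : ℝ) :
    bentHeight (c * M) (c * a) (c * r) = c * bentHeight M a r := by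
  have hM : 0 < M := (abs_nonneg a).trans_lt haM
  have hs : Real.sqrt (M ^ 2 - a ^ 2) ≤ M := by
    rw [Real.sqrt_le_left hM.le]; nlinarith [sq_nonneg a]
  have hs0 : 0 ≤ Real.sqrt (M ^ 2 - a ^ 2) := Real.sqrt_nonneg _
  have hrp : Kerr.rPlus M a ≤ 2 * M := by unfold Kerr.rPlus; linarith
  have hrm : Kerr.rMinus M a ≤ 2 * M := (Kerr.rMinus_le_rPlus M a).trans hrp
  have harg : c * r / (4 * (c * M)) - 1 = r / (4 * M) - 1 := by
    field_simp
  unfold bentHeight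
  rw [harg, rPlus_scale hc, rMinus_scale hc, sqrt_scale hc]
  rcases le_or_gt r (4 * M) with hr | hr
  · -- both sides vanish: `smoothTransition ≤ 0`
    have : r / (4 * M) - 1 ≤ 0 := by
      rw [sub_nonpos, div_le_one (by positivity)]; exact hr
    rw [Real.smoothTransition.zero_of_nonpos this]; ring
  · -- `r > 4M`: all logarithms have positive arguments, `log (c x) = log c + log x`
    have h1 : 0 < r - Kerr.rPlus M a := by linarith
    have h2 : 0 < r - Kerr.rMinus M a := by linarith
    have h3 : 0 < 4 * M - Kerr.rPlus M a := by linarith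
    have h4 : 0 < 4 * M - Kerr.rMinus M a := by linarith
    have e1 : c * r - c * Kerr.rPlus M a = c * (r - Kerr.rPlus M a) := by ring
    have e2 : c * r - c * Kerr.rMinus M a = c * (r - Kerr.rMinus M a) := by ring
    have e3 : 4 * (c * M) - c * Kerr.rPlus M a = c * (4 * M - Kerr.rPlus M a) := by ring
    have e4 : 4 * (c * M) - c * Kerr.rMinus M a = c * (4 * M - Kerr.rMinus M a) := by ring
    rw [e1, e2, e3, e4, Real.log_mul hc.ne' h1.ne', Real.log_mul hc.ne' h2.ne',
      Real.log_mul hc.ne' h3.ne', Real.log_mul hc.ne' h4.ne']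
    have hcs : c * Real.sqrt (M ^ 2 - a ^ 2) ≠ 0 := by
      have : 0 < Real.sqrt (M ^ 2 - a ^ 2) := Real.sqrt_pos.2 (by nlinarith [abs_lt.1 haM])
      positivity
    have hs' : Real.sqrt (M ^ 2 - a ^ 2) ≠ 0 := by
      exact (Real.sqrt_pos.2 (by nlinarith [abs_lt.1 haM])).ne'
    field_simp
    ring

/-- The representative of the bent zero-spin slice map. -/
def bentRep (M : ℝ) : E3 → E4 := fun z ↦
  E4.ofTimeSpace (bentHeight M 0 (Kerr.radius 0 (E4.ofTimeSpace 0 z))) z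

theorem bentRep_eventuallyEq {M : ℝ} (hM : 0 < M) {z : E3} (hz : ‖z‖ < 4 * M) :
    bentRep M =ᶠ[𝓝 z] E4.ofTimeSpace 0 := by
  have ho : IsOpen {z : E3 | ‖z‖ < 4 * M} := isOpen_lt continuous_norm continuous_const
  filter_upwards [ho.mem_nhds hz] with u hu
  simp only [bentRep, Kerr.radius_zero_ofTimeSpace]
  rw [bentHeight_eq_zero hM (le_of_lt hu)]

theorem bentRep_apply {M : ℝ} (hM : 0 < M) {z : E3} (hz : ‖z‖ < 4 * M) :
    bentRep M z = E4.ofTimeSpace 0 z :=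
  (bentRep_eventuallyEq hM hz).self_of_nhds

theorem differentiableAt_bentRep {M : ℝ} (hM : 0 < M) {z : E3} (hz : ‖z‖ < 4 * M) :
    DifferentiableAt ℝ (bentRep M) z :=
  (Kerr.hasFDerivAt_ofTimeSpace_zero z).differentiableAt.congr_of_eventuallyEq
    (bentRep_eventuallyEq hM hz)

theorem fderiv_bentRep {M : ℝ} (hM : 0 < M) {z : E3} (hz : ‖z‖ < 4 * M) (v : E3) :
    fderiv ℝ (bentRep M) z v = E4.ofTimeSpace 0 v := by
  rw [(bentRep_eventuallyEq hM hz).fderiv_eq, Kerr.fderiv_ofTimeSpace_zero]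

/-- Uniqueness of the future unit normal of the slice `{t* = 0}` at `(0,y)` for `a = 0` (local copy;
LANDED in the tree from this seat as `Kerr.eq_sliceNormalRep`, `KerrSliceNormalRigidity.lean`, p69066). -/
theorem eq_sliceNormalRep {M : ℝ} (hM : 0 ≤ M) {y : E3} (hy : y ≠ 0) {n : E4}
    (hn : ∀ w : E3, Kerr.bilin M 0 (E4.ofTimeSpace 0 y) n (E4.ofTimeSpace 0 w) = 0)
    (hu : Kerr.bilin M 0 (E4.ofTimeSpace 0 y) n n = -1)
    (hf : Kerr.bilin M 0 (E4.ofTimeSpace 0 y) (Kerr.timeVector M 0 (E4.ofTimeSpace 0 y)) n < 0) :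
    n = Kerr.sliceNormalRep M y := by
  set x : E4 := E4.ofTimeSpace 0 y with hxdef
  have hx : 0 < Kerr.radius 0 x := by
    rw [hxdef, Kerr.radius_zero_ofTimeSpace]; exact norm_pos_iff.2 hy
  set H : ℝ := Kerr.scalarH M 0 x with hHdef
  set V : E4 := Kerr.timeVector M 0 x with hVdef
  have hH : 0 ≤ H := Kerr.scalarH_nonneg hM 0 x
  have hV1 : ∀ w : E4, Kerr.bilin M 0 x V w = -w 0 := fun w ↦ Kerr.bilin_timeVector hx w
  have hV2 : Kerr.bilin M 0 x V V = -1 - 2 * H := Kerr.bilin_timeVector_timeVector hx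
  have hV0 : V 0 = 1 + 2 * H := by have := hV1 V; rw [hV2] at this; linarith
  have h12 : (0 : ℝ) < 1 + 2 * H := by positivity
  set α : ℝ := n 0 / (1 + 2 * H) with hαdef
  set B : E4 := n - α • V with hBdef
  have hB0 : B 0 = 0 := by
    simp only [hBdef, PiLp.sub_apply, PiLp.smul_apply, smul_eq_mul, hV0, hαdef]
    field_simp
    ring
  have hB : E4.ofTimeSpace 0 (E4.spatial B) = B := by
    have := E4.ofTimeSpace_time_spatial B
    rwa [E4.time_apply, hB0] at this
  -- `g(B, B) = 0`
  have hnB : Kerr.bilin M 0 x n B = 0 := by rw [← hB]; exact hn _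
  have hVB : Kerr.bilin M 0 x V B = 0 := by rw [hV1, hB0, neg_zero]
  have hBB : Kerr.bilin M 0 x B B = 0 := by
    have e : Kerr.bilin M 0 x (n - α • V) B = 0 := by
      have h1 : Kerr.bilin M 0 x (n - α • V) B = Kerr.bilin M 0 x n B - α * Kerr.bilin M 0 x V B := by
        simp only [map_sub, map_smul]
        rfl
      rw [h1, hnB, hVB]; ring
    rwa [← hBdef] at e
  -- positivity of `g` on the slice directions forces `B = 0`
  have hsB : E4.spatial B = 0 := by
    have hpos := Kerr.bilin_zero_ofTimeSpace M hy (E4.spatial B) (E4.spatial B)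
    rw [hB] at hpos
    rw [hpos, Kerr.hRep_apply, real_inner_self_eq_norm_sq] at hBB
    have h1 : 0 ≤ 2 * M / ‖y‖ ^ 3 * (⟪y, E4.spatial B⟫_ℝ * ⟪y, E4.spatial B⟫_ℝ) := by
      have := norm_nonneg y
      have h2 : 0 ≤ ⟪y, E4.spatial B⟫_ℝ * ⟪y, E4.spatial B⟫_ℝ := mul_self_nonneg _
      positivity
    have h3 : ‖E4.spatial B‖ ^ 2 = 0 := by nlinarith [sq_nonneg ‖E4.spatial B‖]
    exact norm_eq_zero.1 (pow_eq_zero_iff two_ne_zero |>.1 h3)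
  have hBzero : B = 0 := by
    rw [← hB, hsB]
    exact map_zero Kerr.sliceEmbedCLM
  have hnV : n = α • V := by
    have : n - α • V = 0 := hBzero
    exact sub_eq_zero.1 this
  -- unit length and future direction pin `α`
  have hαsq : α ^ 2 * (1 + 2 * H) = 1 := by
    rw [hnV] at hu
    simp only [map_smul, FunLike.coe_smul, Pi.smul_apply, smul_eq_mul, hV2] at hu
    nlinarith [hu]
  have hαpos : 0 < α := by
    rw [hnV] at hf
    simp only [map_smul, smul_eq_mul, hV2] at hf
    nlinarith [hf, h12]
  have hα : α = (√(1 + 2 * H))⁻¹ := by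
    rw [← Real.sqrt_inv]
    have : (1 + 2 * H)⁻¹ = α ^ 2 := by
      rw [eq_comm, ← one_div, eq_div_iff h12.ne']
      exact hαsq
    rw [this, Real.sqrt_sq hαpos.le]
  rw [hnV, hα]
  rfl

/-- On the unbent zone the graph `ψ` of the crux IS the Kerr–Schild slice embedding. -/
theorem psi_eq_sliceEmbed {M r₁ : ℝ} (hMpos : 0 < M)
    {ψ : Kerr.slice 0 r₁ → Kerr.region 0 r₁}
    (hψ : ∀ y : Kerr.slice 0 r₁, (ψ y : E4) =
      E4.ofTimeSpace (bentHeight M 0 (Kerr.radius 0 (E4.ofTimeSpace 0 (y : E3)))) (y : E3))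
    {y : Kerr.slice 0 r₁} (hy4 : ‖(y : E3)‖ < 4 * M) :
    ψ y = Kerr.sliceEmbed 0 r₁ y := by
  apply Subtype.ext
  rw [hψ y, Kerr.coe_sliceEmbed]
  exact bentRep_apply hMpos hy4

/-- … and its differential is `v ↦ (0, v)`. -/
theorem mfderiv_psi {M r₁ : ℝ} (hMpos : 0 < M)
    {ψ : Kerr.slice 0 r₁ → Kerr.region 0 r₁}
    (hψ : ∀ y : Kerr.slice 0 r₁, (ψ y : E4) =
      E4.ofTimeSpace (bentHeight M 0 (Kerr.radius 0 (E4.ofTimeSpace 0 (y : E3)))) (y : E3))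
    {y : Kerr.slice 0 r₁} (hy4 : ‖(y : E3)‖ < 4 * M) (v : E3) :
    mfderiv 𝓘(ℝ, E3) 𝓘(ℝ, E4) ψ y v = E4.ofTimeSpace 0 v := by
  rw [OpensChart.mfderiv_apply_of_repr (Φ := bentRep M) hψ (differentiableAt_bentRep hMpos hy4),
    fderiv_bentRep hMpos hy4]

/-- On the unbent zone `‖y‖ < 4M` the future unit normal IS the Kerr–Schild slice normal. -/
theorem nu_eq_sliceNormalRep [Kerr.Facts] {M r₁ : ℝ} (hM : 0 ≤ M) (hMpos : 0 < M)
    {ψ : Kerr.slice 0 r₁ → Kerr.region 0 r₁} {ν : NormalField 𝓘(ℝ, E4) ψ}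
    (hψ : ∀ y : Kerr.slice 0 r₁, (ψ y : E4) =
      E4.ofTimeSpace (bentHeight M 0 (Kerr.radius 0 (E4.ofTimeSpace 0 (y : E3)))) (y : E3))
    (hν : (Kerr.smoothMetric M 0 r₁).IsFutureUnitNormal 𝓘(ℝ, E3)
      ((Kerr.timeOrientation M 0 r₁ hM).ofLE le_top) ψ ν)
    {y : Kerr.slice 0 r₁} (hy4 : ‖(y : E3)‖ < 4 * M) :
    ν y = Kerr.sliceNormalRep M y := by
  have hy : (y : E3) ≠ 0 := Kerr.ne_zero_of_mem_slice_zero y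
  have hψy : (ψ y : E4) = E4.ofTimeSpace 0 y := by
    rw [psi_eq_sliceEmbed hMpos hψ hy4, Kerr.coe_sliceEmbed]
  have h1 : ∀ w : E3, Kerr.bilin M 0 (E4.ofTimeSpace 0 y) (ν y) (E4.ofTimeSpace 0 w) = 0 := by
    intro w
    have := hν.1.1 y w
    rw [mfderiv_psi hMpos hψ hy4] at this
    rw [← hψy]
    exact this
  have h2 : Kerr.bilin M 0 (E4.ofTimeSpace 0 y) (ν y) (ν y) = -1 := by
    rw [← hψy]; exact hν.1.2 y
  have h3 : Kerr.bilin M 0 (E4.ofTimeSpace 0 y)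
      (Kerr.timeVector M 0 (E4.ofTimeSpace 0 y)) (ν y) < 0 := by
    rw [← hψy]; exact (hν.2 y).2
  exact eq_sliceNormalRep hM hy h1 h2 h3

/-- Second fundamental form of a map `f : slice 0 r₁ → region 0 r₁` with field `ν`, at a point
where `(f, ν)` has representatives tangent to the unbent Kerr–Schild slice to first order:
the `½ (∂g)` form (local copy; LANDED as `Kerr.secondFundamentalForm_eq_half_of_repr`, p69066). -/
theorem sff_eq_half_of_repr [Kerr.Facts] {M r₁ : ℝ} (hM : 0 ≤ M)
    [(Kerr.smoothMetric M 0 r₁).HasLeviCivita]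
    {f : Kerr.slice 0 r₁ → Kerr.region 0 r₁} {Φ : E3 → E4} (hf : ∀ y, (f y : E4) = Φ y)
    {ν : NormalField 𝓘(ℝ, E4) f} {N : E3 → E4} (hν : ∀ y, ν y = N y)
    {y : Kerr.slice 0 r₁} (hΦd : DifferentiableAt ℝ Φ y) (hNd : DifferentiableAt ℝ N y)
    (hfy : f y = Kerr.sliceEmbed 0 r₁ y)
    (hΦ' : ∀ v : E3, fderiv ℝ Φ y v = E4.ofTimeSpace 0 v)
    (hNy : N y = Kerr.sliceNormalRep M y)
    (hN' : fderiv ℝ N y = fderiv ℝ (Kerr.sliceNormalRep M) y) (v w : E3) :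
    (Kerr.smoothMetric M 0 r₁).secondFundamentalForm 𝓘(ℝ, E3) f ν y v w =
      2⁻¹ * (fderiv ℝ (Kerr.bilin M 0) (E4.ofTimeSpace 0 y) (Kerr.sliceNormalRep M y)
            (E4.ofTimeSpace 0 w) (E4.ofTimeSpace 0 v)
          - fderiv ℝ (Kerr.bilin M 0) (E4.ofTimeSpace 0 y) (E4.ofTimeSpace 0 v)
            (Kerr.sliceNormalRep M y) (E4.ofTimeSpace 0 w)
          - fderiv ℝ (Kerr.bilin M 0) (E4.ofTimeSpace 0 y) (E4.ofTimeSpace 0 w)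
            (E4.ofTimeSpace 0 v) (Kerr.sliceNormalRep M y)) := by
  have hy : (y : E3) ≠ 0 := Kerr.ne_zero_of_mem_slice_zero y
  rw [OpensChart.secondFundamentalForm_eq_of_repr
    (g := (Kerr.smoothMetric M 0 r₁).toPseudoRiemannianMetric)
    (G := Kerr.bilin M 0) (Kerr.smoothMetric_val M 0 r₁) hf hν hΦd hNd
    (Kerr.differentiableAt_bilin M 0 _) v w, hN', hNy, hΦ', hΦ', hfy]
  -- the Christoffel symbols of the first kind: `g(Γ(N)(ṽ), w̃) = ½ K(N, ṽ, w̃)`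
  have hΓ := OpensChart.val_christoffel_const
    (g := (Kerr.smoothMetric M 0 r₁).toPseudoRiemannianMetric)
    (G := Kerr.bilin M 0) (Kerr.sliceEmbed 0 r₁ y) (Kerr.sliceNormalRep M y)
    (E4.ofTimeSpace 0 v) (E4.ofTimeSpace 0 w)
  have hΓ' : Kerr.bilin M 0 (E4.ofTimeSpace 0 y) (OpensChart.christoffel
      (Kerr.smoothMetric M 0 r₁).toPseudoRiemannianMetric (Kerr.bilin M 0)
      (Kerr.sliceEmbed 0 r₁ y) (Kerr.sliceNormalRep M y) (E4.ofTimeSpace 0 v))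
      (E4.ofTimeSpace 0 w) =
      2⁻¹ * OpensChart.koszulForm (Kerr.bilin M 0) (E4.ofTimeSpace 0 y)
        (Kerr.sliceNormalRep M y) (E4.ofTimeSpace 0 v) (E4.ofTimeSpace 0 w) := hΓ
  show Kerr.bilin M 0 (E4.ofTimeSpace 0 y) (fderiv ℝ (Kerr.sliceNormalRep M) y v +
      OpensChart.christoffel (Kerr.smoothMetric M 0 r₁).toPseudoRiemannianMetric
      (Kerr.bilin M 0) (Kerr.sliceEmbed 0 r₁ y) (Kerr.sliceNormalRep M y)
      (E4.ofTimeSpace 0 v)) (E4.ofTimeSpace 0 w) = _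
  rw [map_add, _root_.add_apply, hΓ', OpensChart.koszulForm_apply,
    Kerr.bilin_fderiv_sliceNormalRep hM hy v w]
  ring

-- the closing `field_simp`/`ring` normalisation handles a moderately large rational expression
set_option maxHeartbeats 400000 in
/-- … and in closed form: `K(v, w) = kRep M y v w` (local copy; LANDED as
`Kerr.secondFundamentalForm_eq_kRep_of_repr`, p69066). -/
theorem sff_eq_kRep_of_repr [Kerr.Facts] {M r₁ : ℝ} (hM : 0 ≤ M)
    [(Kerr.smoothMetric M 0 r₁).HasLeviCivita]
    {f : Kerr.slice 0 r₁ → Kerr.region 0 r₁} {Φ : E3 → E4} (hf : ∀ y, (f y : E4) = Φ y)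
    {ν : NormalField 𝓘(ℝ, E4) f} {N : E3 → E4} (hν : ∀ y, ν y = N y)
    {y : Kerr.slice 0 r₁} (hΦd : DifferentiableAt ℝ Φ y) (hNd : DifferentiableAt ℝ N y)
    (hfy : f y = Kerr.sliceEmbed 0 r₁ y)
    (hΦ' : ∀ v : E3, fderiv ℝ Φ y v = E4.ofTimeSpace 0 v)
    (hNy : N y = Kerr.sliceNormalRep M y)
    (hN' : fderiv ℝ N y = fderiv ℝ (Kerr.sliceNormalRep M) y) (v w : E3) :
    (Kerr.smoothMetric M 0 r₁).secondFundamentalForm 𝓘(ℝ, E3) f ν y v w =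
      Kerr.kRep M y v w := by
  have hy : (y : E3) ≠ 0 := Kerr.ne_zero_of_mem_slice_zero y
  have hr : ‖(y : E3)‖ ≠ 0 := norm_ne_zero_iff.2 hy
  have hsp : E4.spatial (E4.ofTimeSpace 0 (y : E3)) ≠ 0 := by rwa [E4.spatial_ofTimeSpace]
  have hS : √(1 + 2 * M / ‖(y : E3)‖) ≠ 0 :=
    (Real.sqrt_pos.2 (by have := Kerr.norm_pos_of_mem_slice_zero y; positivity)).ne'
  rw [sff_eq_half_of_repr hM hf hν hΦd hNd hfy hΦ' hNy hN' v w]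
  have h1 : ⟪v, (y : E3)⟫_ℝ = ⟪(y : E3), v⟫_ℝ := real_inner_comm _ _
  have h2 : ⟪w, (y : E3)⟫_ℝ = ⟪(y : E3), w⟫_ℝ := real_inner_comm _ _
  have h3 : ⟪w, v⟫_ℝ = ⟪v, w⟫_ℝ := real_inner_comm _ _
  simp only [Kerr.fderiv_bilin_zero_apply M hsp, Kerr.bilinZeroDeriv_apply,
    Kerr.nullCovectorZero_apply, Kerr.nullCovectorZeroDeriv_apply, E4.spatial_ofTimeSpace,
    E4.ofTimeSpace_apply_zero, Kerr.sliceNormalRep_apply_zero M hy,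
    Kerr.spatial_sliceNormalRep M hy, inner_smul_left, inner_smul_right,
    real_inner_self_eq_norm_sq, Kerr.kRep]
  simp only [h1, h2, h3, conj_trivial]
  field_simp
  ring


/-- **`h` of a zero-spin shielded datum on the unbent zone** is the Kerr–Schild slice metric in
closed form: `h_{φ y}(dφ v, dφ w) = hRep M y v w = ⟪v, w⟫ + (2M/‖y‖³) ⟪y, v⟫⟪y, w⟫` for `‖y‖ < 4M`
(Cook 2000, (55)). [cite: Cook2000, §3.2.2 (55)] -/
theorem h_pullback_eq_hRep [Kerr.Facts] {X : Type*} [TopologicalSpace X] [ChartedSpace E3 X]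
    [IsManifold (𝓡 3) ∞ X] (D : InitialDataSet (𝓡 3) X) {M r₁ : ℝ} (hMpos : 0 < M)
    {φ : Kerr.slice 0 r₁ → X} {ψ : Kerr.slice 0 r₁ → Kerr.region 0 r₁}
    (hψ : ∀ y : Kerr.slice 0 r₁, (ψ y : E4) =
      E4.ofTimeSpace (bentHeight M 0 (Kerr.radius 0 (E4.ofTimeSpace 0 (y : E3)))) (y : E3))
    (hh : ∀ y : Kerr.slice 0 r₁,
      pullbackBilin (I := 𝓡 3) (I' := 𝓘(ℝ, E3)) φ D.h.inner y =
        pullbackBilin (I := 𝓘(ℝ, E4)) (I' := 𝓘(ℝ, E3)) ψ (Kerr.smoothMetric M 0 r₁).val y)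
    {y : Kerr.slice 0 r₁} (hy4 : ‖(y : E3)‖ < 4 * M) (v w : E3) :
    D.h.inner (φ y) (mfderiv 𝓘(ℝ, E3) (𝓡 3) φ y v) (mfderiv 𝓘(ℝ, E3) (𝓡 3) φ y w) =
      Kerr.hRep M y v w := by
  have hy : (y : E3) ≠ 0 := Kerr.ne_zero_of_mem_slice_zero y
  have e : D.h.inner (φ y) (mfderiv 𝓘(ℝ, E3) (𝓡 3) φ y v) (mfderiv 𝓘(ℝ, E3) (𝓡 3) φ y w) =
      (Kerr.smoothMetric M 0 r₁).val (ψ y) (mfderiv 𝓘(ℝ, E3) 𝓘(ℝ, E4) ψ y v)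
        (mfderiv 𝓘(ℝ, E3) 𝓘(ℝ, E4) ψ y w) :=
    DFunLike.congr_fun (DFunLike.congr_fun (hh y) v) w
  rw [e, mfderiv_psi hMpos hψ hy4, mfderiv_psi hMpos hψ hy4, Kerr.smoothMetric_val,
    psi_eq_sliceEmbed hMpos hψ hy4, Kerr.coe_sliceEmbed]
  exact Kerr.bilin_zero_ofTimeSpace M hy v w

open scoped Classical in
/-- **`k` of a zero-spin shielded datum on the unbent zone.** For a Schwarzschild (`a = 0`)
shield `(φ, ψ, ν)` of `D` and a junction-side point `y` with `‖y‖ < 4M` (where the bent slice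
is still the Kerr–Schild slice `{t* = 0}`), the pulled-back second fundamental form is the
closed form `kRep` of `KerrDataSchwarzschildExtrinsic.lean`:
`k_{φ y}(dφ v, dφ w) = −(2M/(r²√(1+2M/r))) (⟪v,w⟫ − (2 + M/r)⟪y,v⟫⟪y,w⟫/r²)`. -/
theorem k_pullback_eq_kRep [Kerr.Facts] {X : Type*} [TopologicalSpace X] [ChartedSpace E3 X]
    [IsManifold (𝓡 3) ∞ X] (D : InitialDataSet (𝓡 3) X) {M r₁ : ℝ} (hM : 0 ≤ M) (hMpos : 0 < M)
    {φ : Kerr.slice 0 r₁ → X} {ψ : Kerr.slice 0 r₁ → Kerr.region 0 r₁}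
    {ν : NormalField 𝓘(ℝ, E4) ψ}
    (hψ : ∀ y : Kerr.slice 0 r₁, (ψ y : E4) =
      E4.ofTimeSpace (bentHeight M 0 (Kerr.radius 0 (E4.ofTimeSpace 0 (y : E3)))) (y : E3))
    (hν : (Kerr.smoothMetric M 0 r₁).IsFutureUnitNormal 𝓘(ℝ, E3)
      ((Kerr.timeOrientation M 0 r₁ hM).ofLE le_top) ψ ν)
    (hk : ∀ [(Kerr.smoothMetric M 0 r₁).HasLeviCivita] (y : Kerr.slice 0 r₁),
      (pullbackBilin (I := 𝓡 3) (I' := 𝓘(ℝ, E3)) φ D.k y).toLinearMap₁₂ =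
        (Kerr.smoothMetric M 0 r₁).secondFundamentalForm 𝓘(ℝ, E3) ψ ν y)
    {y : Kerr.slice 0 r₁} (hy4 : ‖(y : E3)‖ < 4 * M) (v w : E3) :
    D.k (φ y) (mfderiv 𝓘(ℝ, E3) (𝓡 3) φ y v) (mfderiv 𝓘(ℝ, E3) (𝓡 3) φ y w) =
      Kerr.kRep M y v w := by
  have hy : (y : E3) ≠ 0 := Kerr.ne_zero_of_mem_slice_zero y
  haveI : (Kerr.smoothMetric M 0 r₁).HasLeviCivita := PseudoRiemannianMetric.hasLeviCivita _
  -- global representatives of `ψ` and `ν`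
  have hψ' : ∀ y : Kerr.slice 0 r₁, (ψ y : E4) = bentRep M y := hψ
  set N : E3 → E4 := fun z ↦ if hz : z ∈ Kerr.slice 0 r₁ then (ν ⟨z, hz⟩ : E4) else 0
    with hNdef
  have hνN : ∀ y : Kerr.slice 0 r₁, ν y = N y := fun y ↦ by
    simp only [hNdef, dif_pos y.2]
  have hNloc : N =ᶠ[𝓝 (y : E3)] Kerr.sliceNormalRep M := by
    have ho : IsOpen {z : E3 | z ∈ Kerr.slice 0 r₁ ∧ ‖z‖ < 4 * M} :=
      (Kerr.slice 0 r₁).2.inter (isOpen_lt continuous_norm continuous_const)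
    filter_upwards [ho.mem_nhds ⟨y.2, hy4⟩] with z hz
    simp only [hNdef, dif_pos hz.1]
    exact nu_eq_sliceNormalRep hM hMpos hψ hν (y := ⟨z, hz.1⟩) hz.2
  have hNd : DifferentiableAt ℝ N y :=
    (Kerr.differentiableAt_sliceNormalRep hM hy).congr_of_eventuallyEq hNloc
  have hN' : fderiv ℝ N y = fderiv ℝ (Kerr.sliceNormalRep M) y := hNloc.fderiv_eq
  have hNy : N y = Kerr.sliceNormalRep M y := hNloc.self_of_nhds
  have e := LinearMap.congr_fun₂ (hk y) v w
  calc D.k (φ y) (mfderiv 𝓘(ℝ, E3) (𝓡 3) φ y v) (mfderiv 𝓘(ℝ, E3) (𝓡 3) φ y w)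
      = (pullbackBilin (I := 𝓡 3) (I' := 𝓘(ℝ, E3)) φ D.k y).toLinearMap₁₂ v w := rfl
    _ = (Kerr.smoothMetric M 0 r₁).secondFundamentalForm 𝓘(ℝ, E3) ψ ν y v w := e
    _ = Kerr.kRep M y v w :=
        sff_eq_kRep_of_repr hM hψ' hνN (differentiableAt_bentRep hMpos hy4) hNd
          (psi_eq_sliceEmbed hMpos hψ hy4) (fderiv_bentRep hMpos hy4) hNy hN' v w

/-- The test point `y₀ = (0, 0, 3M)` and test vector `e₀`: `kRep M y₀ e₀ e₀ < 0`. -/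
theorem kRep_testPoint_neg {M : ℝ} (hM : 0 < M) :
    Kerr.kRep M ((3 * M) • EuclideanSpace.single (2 : Fin 3) (1 : ℝ))
      (EuclideanSpace.single 0 1) (EuclideanSpace.single 0 1) < 0 := by
  have hn : ‖(3 * M) • EuclideanSpace.single (2 : Fin 3) (1 : ℝ)‖ = 3 * M := by
    rw [norm_smul, PiLp.norm_single, Real.norm_eq_abs, norm_one, mul_one,
      abs_of_pos (by positivity)]
  have hin : ⟪(3 * M) • EuclideanSpace.single (2 : Fin 3) (1 : ℝ),
      EuclideanSpace.single (0 : Fin 3) (1 : ℝ)⟫_ℝ = 0 := by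
    rw [inner_smul_left, EuclideanSpace.inner_single_left]
    simp
  have hvv : ⟪EuclideanSpace.single (0 : Fin 3) (1 : ℝ), EuclideanSpace.single (0 : Fin 3) (1 : ℝ)⟫_ℝ = 1 := by
    rw [EuclideanSpace.inner_single_left]
    simp
  rw [Kerr.kRep, hn, hin, hvv]
  have h1 : 0 < 2 * M / ((3 * M) ^ 2 * √(1 + 2 * M / (3 * M))) := by positivity
  nlinarith [h1]


/-! ## §5  TEETH of the typed predicate / a natural strengthening refuted (zero spin)

`S_{M,0,r₁}(D)` forces `k ≢ 0` (the horizon-penetrating Kerr–Schild part of the slice is not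
time-symmetric): at the test point `y₀ = (0,0,3M)` (`r₁ < 2M < 3M < 4M`) and `v = e₀ ⊥ y₀`,
`k(dφ v, dφ v) = kRep M y₀ v v = −2M/(9M² √(5/3)) < 0`. Consequences:
* no TIME-SYMMETRIC datum (flat data, Brill–Lindquist, Misner, …) is Schwarzschild-shielded;
* in particular the strengthening of the crux in which the member `F 0 = d` is ALSO shielded
  (drop `c ≠ 0`) is false at `d = trivialData` for zero-spin shields, and "every admissible datum
  is itself shielded" (which would make constant families work) is false. -/

/-- **Zero-spin shields force `k ≢ 0`.** -/
theorem exists_k_ne_zero_of_isKerrShieldedWith_zero [Kerr.Facts] {X : Type} [TopologicalSpace X]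
    [ChartedSpace E3 X] [IsManifold (𝓡 3) ∞ X] {D : InitialDataSet (𝓡 3) X} {M r₁ : ℝ}
    (h : IsKerrShieldedWith M 0 r₁ X D) : ∃ x, D.k x ≠ 0 := by
  obtain ⟨hM, T, φ, ψ, ν, haM, -, hr₁', hT, -, -, -, hψ, -, hν, -, hk⟩ := h
  have hMpos : 0 < M := by simpa using haM
  subst hT
  -- the test point `y₀ = (0, 0, 3M)` of the unbent zone
  set y₀E : E3 := (3 * M) • EuclideanSpace.single (2 : Fin 3) (1 : ℝ) with hy₀E
  have hnorm : ‖y₀E‖ = 3 * M := by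
    rw [hy₀E, norm_smul, PiLp.norm_single, Real.norm_eq_abs, norm_one, mul_one,
      abs_of_pos (by positivity)]
  have hmem : y₀E ∈ Kerr.slice 0 r₁ := by
    rw [Kerr.mem_slice_zero_iff, hnorm]
    have : r₁ < 2 * M := by rwa [Kerr.rPlus_zero_right hM] at hr₁'
    exact max_lt (by linarith) (by positivity)
  set y₀ : Kerr.slice 0 r₁ := ⟨y₀E, hmem⟩ with hy₀
  have hy4 : ‖(y₀ : E3)‖ < 4 * M := by
    show ‖y₀E‖ < 4 * M
    rw [hnorm]; linarith
  have key := k_pullback_eq_kRep D hM hMpos hψ hν hk hy4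
    (EuclideanSpace.single 0 1) (EuclideanSpace.single 0 1)
  have hneg := kRep_testPoint_neg hMpos
  refine ⟨φ y₀, fun h0 ↦ ?_⟩
  rw [h0] at key
  have : Kerr.kRep M (y₀ : E3) (EuclideanSpace.single 0 1) (EuclideanSpace.single 0 1) = 0 := by
    rw [← key]; rfl
  exact hneg.ne (by simpa [hy₀] using this)

/-- **No time-symmetric datum is Schwarzschild-shielded** (`k = 0` vs `k(dφ e₀, dφ e₀) < 0`). -/
theorem not_isKerrShieldedWith_zero_of_isTimeSymmetric [Kerr.Facts] {X : Type}
    [TopologicalSpace X] [ChartedSpace E3 X] [IsManifold (𝓡 3) ∞ X]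
    {D : InitialDataSet (𝓡 3) X} (hD : D.IsTimeSymmetric) (M r₁ : ℝ) :
    ¬ IsKerrShieldedWith M 0 r₁ X D := fun h ↦ by
  obtain ⟨x, hx⟩ := exists_k_ne_zero_of_isKerrShieldedWith_zero h
  exact hx (hD x)

/-- In particular flat data `(ℝ³, δ, 0)` carry no zero-spin shield: the strengthening of the
crux in which the member `F 0 = d` is also (Schwarzschild-)shielded is FALSE at
`d = trivialData`. -/
theorem not_isKerrShieldedWith_zero_trivialData [Kerr.Facts] (M r₁ : ℝ) :
    ¬ IsKerrShieldedWith M 0 r₁ Minkowski.slice trivialData :=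
  not_isKerrShieldedWith_zero_of_isTimeSymmetric trivialData_isTimeSymmetric M r₁

/-- The degenerate strengthening "every admissible datum is ITSELF Schwarzschild-shielded" (under
which constant families would witness the crux) is false. -/
theorem not_forall_admissible_isKerrShieldedWith_zero :
    ¬ ∀ [Kerr.Facts] (X : Type) [TopologicalSpace X] [ChartedSpace E3 X]
        [IsManifold (𝓡 3) ∞ X] [T2Space X] [SecondCountableTopology X] [ConnectedSpace X],
        ∀ D ∈ admissibleVacuumData X, ∃ M r₁, IsKerrShieldedWith M 0 r₁ X D := by
  intro h
  obtain ⟨M, r₁, hS⟩ := h Minkowski.slice trivialData trivialData_mem_admissibleVacuumData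
  exact not_isKerrShieldedWith_zero_trivialData M r₁ hS

/-! ## §6  INTRINSIC teeth (cycle 2): the scalar curvature of a zero-spin shielded datum on the
unbent zone is `8M²/(r²(r+2M)²) > 0`

Cycle 1 read the *extrinsic* part `k` of a Schwarzschild shield in closed form (§4–§5). With the
tree's naturality of the scalar curvature under local diffeomorphisms
(`PseudoRiemannianMetric.scalarCurvature_comap`, O'Neill Prop. 3.59) and the coordinate formula
on open subsets of `E3` (`OpensChart.scalarCurvature_eq_coord`) we now read the *intrinsic*
geometry: on the unbent zone `‖y‖ < 4M` the shield map `φ` is a local isometry from Cook's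
Kerr–Schild slice metric `hRep M = δ + (2M/r³) y ⊗ y` to `(X, h)`, hence
`R(h)(φ y) = R(hRep)(y) = 8M²/(‖y‖²(‖y‖+2M)²)` (Cook 2000 (55)–(57); the tree's
`Kerr.scalarCurvature_data_zero`, whose `[Kerr.SliceFacts]` hypothesis we avoid by pulling `h`
back along `φ` instead of using `Kerr.data`). Consequences (zero spin): a Schwarzschild-shielded
datum has a point of POSITIVE scalar curvature; no datum with `R(h) ≤ 0` everywhere — in
particular no scalar-flat datum (every time-symmetric vacuum datum, every datum with
`|k|² = (tr k)²`) — carries a zero-spin shield. This is the brick on which the c → 0 analysis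
of §7 rests. -/

/-- The **unbent zone** `{y ∈ slice 0 r₁ | ‖y‖ < 4M}` as an open subset of `E3`. -/
def unbentZone (M r₁ : ℝ) : TopologicalSpace.Opens E3 :=
  ⟨{z : E3 | z ∈ Kerr.slice 0 r₁ ∧ ‖z‖ < 4 * M},
    (Kerr.slice 0 r₁).2.inter (isOpen_lt continuous_norm continuous_const)⟩

theorem mem_unbentZone {M r₁ : ℝ} {z : E3} :
    z ∈ unbentZone M r₁ ↔ z ∈ Kerr.slice 0 r₁ ∧ ‖z‖ < 4 * M := Iff.rfl

/-- The inclusion of the unbent zone into the slice. -/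
def unbentIncl (M r₁ : ℝ) : unbentZone M r₁ → Kerr.slice 0 r₁ := fun q ↦ ⟨q.1, q.2.1⟩

theorem coe_unbentIncl (M r₁ : ℝ) (q : unbentZone M r₁) : (unbentIncl M r₁ q : E3) = q := rfl

theorem contMDiff_unbentIncl (M r₁ : ℝ) :
    ContMDiff 𝓘(ℝ, E3) 𝓘(ℝ, E3) ∞ (unbentIncl M r₁) := by
  rw [← ContMDiff.subtypeVal_comp_iff]
  exact contMDiff_subtype_val

theorem mfderiv_unbentIncl (M r₁ : ℝ) (q : unbentZone M r₁) :
    mfderiv 𝓘(ℝ, E3) 𝓘(ℝ, E3) (unbentIncl M r₁) q = ContinuousLinearMap.id ℝ E3 := by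
  have h1 : mfderiv 𝓘(ℝ, E3) 𝓘(ℝ, E3) (Subtype.val ∘ unbentIncl M r₁) q =
      (mfderiv 𝓘(ℝ, E3) 𝓘(ℝ, E3) (Subtype.val : Kerr.slice 0 r₁ → E3) (unbentIncl M r₁ q)).comp
        (mfderiv 𝓘(ℝ, E3) 𝓘(ℝ, E3) (unbentIncl M r₁) q) :=
    mfderiv_comp q ((contMDiff_subtype_val (n := (1 : ℕ∞ω))).mdifferentiableAt one_ne_zero)
      ((contMDiff_unbentIncl M r₁).mdifferentiableAt (by simp))
  have h2 : mfderiv 𝓘(ℝ, E3) 𝓘(ℝ, E3) (Subtype.val ∘ unbentIncl M r₁) q =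
      ContinuousLinearMap.id ℝ E3 := mfderiv_subtypeVal q
  rw [h2, mfderiv_subtypeVal] at h1
  rw [h1]
  rfl

/-- `hRep` is positive definite away from the origin (for `M ≥ 0`). [folklore] -/
theorem hRep_pos {M : ℝ} (hM : 0 ≤ M) {y : E3} (hy : y ≠ 0) {v : E3} (hv : v ≠ 0) :
    0 < Kerr.hRep M y v v := by
  rw [Kerr.hRep_apply, real_inner_self_eq_norm_sq]
  have h1 : 0 < ‖v‖ ^ 2 := by positivity
  have h2 : 0 ≤ 2 * M / ‖y‖ ^ 3 * (⟪y, v⟫_ℝ * ⟪y, v⟫_ℝ) := by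
    have := mul_self_nonneg ⟪y, v⟫_ℝ
    positivity
  linarith

/-- **The scalar curvature of a zero-spin shielded datum on the unbent zone.** If `φ^*h = ψ^*g`
for the bent zero-spin graph `ψ` (so `ψ = sliceEmbed` where `‖y‖ < 4M`) and `φ` is smooth, then
`R(h)(φ y) = 8M²/(‖y‖²(‖y‖ + 2M)²)` for every `y` of the slice with `‖y‖ < 4M`.
[cite: Cook2000, §3.2.2 (55)–(57)] [cite: ONeill1983, Ch. 3, Prop. 3.59] -/
theorem scalarCurvature_shield_unbent [Kerr.Facts] {X : Type} [TopologicalSpace X]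
    [ChartedSpace E3 X] [IsManifold (𝓡 3) ∞ X] (D : InitialDataSet (𝓡 3) X)
    [D.metric.HasLeviCivita] {M r₁ : ℝ} (hMpos : 0 < M)
    {φ : Kerr.slice 0 r₁ → X} {ψ : Kerr.slice 0 r₁ → Kerr.region 0 r₁}
    (hφ : ContMDiff 𝓘(ℝ, E3) (𝓡 3) ∞ φ)
    (hψ : ∀ y : Kerr.slice 0 r₁, (ψ y : E4) =
      E4.ofTimeSpace (bentHeight M 0 (Kerr.radius 0 (E4.ofTimeSpace 0 (y : E3)))) (y : E3))
    (hh : ∀ y : Kerr.slice 0 r₁,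
      pullbackBilin (I := 𝓡 3) (I' := 𝓘(ℝ, E3)) φ D.h.inner y =
        pullbackBilin (I := 𝓘(ℝ, E4)) (I' := 𝓘(ℝ, E3)) ψ (Kerr.smoothMetric M 0 r₁).val y)
    {y : Kerr.slice 0 r₁} (hy4 : ‖(y : E3)‖ < 4 * M) :
    D.metric.scalarCurvature (φ y) =
      8 * M ^ 2 / (‖(y : E3)‖ ^ 2 * (‖(y : E3)‖ + 2 * M) ^ 2) := by
  -- the local isometry `Φ = φ ∘ ι : unbentZone → X`
  set Φ : unbentZone M r₁ → X := φ ∘ unbentIncl M r₁ with hΦdef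
  have hΦ : ContMDiff 𝓘(ℝ, E3) (𝓡 3) (∞ + 1) Φ :=
    hφ.comp (contMDiff_unbentIncl M r₁)
  have hmf : ∀ q : unbentZone M r₁, mfderiv 𝓘(ℝ, E3) (𝓡 3) Φ q =
      mfderiv 𝓘(ℝ, E3) (𝓡 3) φ (unbentIncl M r₁ q) := fun q ↦ by
    rw [hΦdef, mfderiv_comp q (hφ.mdifferentiableAt (by simp))
      ((contMDiff_unbentIncl M r₁).mdifferentiableAt (by simp)), mfderiv_unbentIncl]
    exact ContinuousLinearMap.comp_id _
  -- its pullback metric has representative `hRep`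
  have hval : ∀ q : unbentZone M r₁, ∀ v w : E3,
      pullbackBilin (I := 𝓡 3) (I' := 𝓘(ℝ, E3)) Φ D.metric.val q v w = Kerr.hRep M q v w := by
    intro q v w
    rw [pullbackBilin_apply, hmf q, InitialDataSet.val_metric]
    exact h_pullback_eq_hRep D hMpos hψ hh (y := unbentIncl M r₁ q) q.2.2 v w
  have hΦ' : ∀ q, Function.Injective (mfderiv 𝓘(ℝ, E3) (𝓡 3) Φ q) := by
    intro q v w hvw
    have hq0 : (q : E3) ≠ 0 := Kerr.ne_zero_of_mem_slice_zero (unbentIncl M r₁ q)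
    have h0 : mfderiv 𝓘(ℝ, E3) (𝓡 3) Φ q (v - w) = 0 := by
      rw [ContinuousLinearMap.map_sub, hvw, sub_self]
    have hzero : Kerr.hRep M q (v - w) (v - w) = 0 := by
      rw [← hval q, pullbackBilin_apply, h0]
      simp
    by_contra hne
    exact (hRep_pos hMpos.le hq0 (sub_ne_zero.2 hne)).ne' hzero
  set G := D.metric.comap (PseudoRiemannianMetric.contMDiff_pullbackBilin_holds
    (I := 𝓡 3) (M := X) (I' := 𝓘(ℝ, E3)) (N := unbentZone M r₁)) Φ hΦ hΦ' rfl with hGdef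
  haveI := G.hasLeviCivita
  have hG : ∀ q : unbentZone M r₁, G.val q = Kerr.hRep M q := fun q ↦
    ContinuousLinearMap.ext fun v ↦ ContinuousLinearMap.ext fun w ↦ hval q v w
  -- naturality
  set q₀ : unbentZone M r₁ := ⟨(y : E3), y.2, hy4⟩ with hq₀
  have hnat : G.scalarCurvature q₀ = D.metric.scalarCurvature (Φ q₀) :=
    PseudoRiemannianMetric.scalarCurvature_comap D.metric _ hΦ hΦ' rfl q₀
  have hΦq₀ : Φ q₀ = φ y := by
    simp only [hΦdef, Function.comp_apply, unbentIncl, hq₀]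
  rw [← hΦq₀, ← hnat]
  -- the coordinate computation (verbatim the proof of `Kerr.scalarCurvature_data_zero`)
  have hy : (y : E3) ≠ 0 := Kerr.ne_zero_of_mem_slice_zero y
  have hr : ‖(y : E3)‖ ≠ 0 := norm_ne_zero_iff.2 hy
  have hrM : ‖(y : E3)‖ + 2 * M ≠ 0 := by
    have := Kerr.norm_pos_of_mem_slice_zero y; positivity
  obtain ⟨b, hb⟩ := Kerr.exists_orthonormalBasis_adapted hy
  set β : Module.Basis (Fin 3) ℝ (TangentSpace 𝓘(ℝ, E3) q₀) := b.toBasis with hβdef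
  have hβ : ∀ i, β i = b i := fun i ↦ congrFun b.coe_toBasis i
  rw [OpensChart.scalarCurvature_eq_coord hG q₀ β]
  simp only [hβ]
  show _ = 8 * M ^ 2 / (‖(y : E3)‖ ^ 2 * (‖(y : E3)‖ + 2 * M) ^ 2)
  have hq₀E : ((q₀ : unbentZone M r₁) : E3) = (y : E3) := rfl
  simp only [hq₀E]
  rw [Kerr.gram_hRep_adapted_inv hy b hb hrM]
  simp only [Kerr.koszulForm_hRep M hy, Kerr.fderiv_koszulForm_hRep M hy]
  simp only [Matrix.diagonal_apply, ite_mul, zero_mul, Finset.sum_ite_eq', Finset.mem_univ,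
    if_true]
  simp only [Kerr.cKS_adapted b hb, Kerr.dcKS_adapted b hb, Kerr.inner_adapted b hb,
    Kerr.inner_basis b, Fin.sum_univ_three, Fin.isValue, Matrix.cons_val_zero,
    Matrix.cons_val_one, Matrix.cons_val,
    if_true, show ((0 : Fin 3) = 2) = False by decide, show ((1 : Fin 3) = 2) = False by decide,
    show ((0 : Fin 3) = 1) = False by decide, show ((1 : Fin 3) = 0) = False by decide,
    show ((2 : Fin 3) = 0) = False by decide, show ((2 : Fin 3) = 1) = False by decide, if_false,
    mul_zero, zero_mul, mul_one, one_mul, add_zero, zero_add, sub_zero]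
  field_simp
  ring


/-- **Zero-spin shields have a point of positive scalar curvature**: `R(h)(φ y₀) = 8/(225 M²)`
at the image of the test point `y₀ = (0,0,3M)` of the unbent zone. -/
theorem exists_scalarCurvature_pos_of_isKerrShieldedWith_zero [Kerr.Facts] {X : Type}
    [TopologicalSpace X] [ChartedSpace E3 X] [IsManifold (𝓡 3) ∞ X]
    {D : InitialDataSet (𝓡 3) X} [D.metric.HasLeviCivita] {M r₁ : ℝ}
    (h : IsKerrShieldedWith M 0 r₁ X D) :
    ∃ x, D.metric.scalarCurvature x = 8 / (225 * M ^ 2) ∧ 0 < D.metric.scalarCurvature x := by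
  obtain ⟨hM, T, φ, ψ, ν, haM, -, hr₁', hT, -, -, hφs, hψ, -, -, hh, -⟩ := h
  have hMpos : 0 < M := by simpa using haM
  subst hT
  set y₀E : E3 := (3 * M) • EuclideanSpace.single (2 : Fin 3) (1 : ℝ) with hy₀E
  have hnorm : ‖y₀E‖ = 3 * M := by
    rw [hy₀E, norm_smul, PiLp.norm_single, Real.norm_eq_abs, norm_one, mul_one,
      abs_of_pos (by positivity)]
  have hmem : y₀E ∈ Kerr.slice 0 r₁ := by
    rw [Kerr.mem_slice_zero_iff, hnorm]
    have : r₁ < 2 * M := by rwa [Kerr.rPlus_zero_right hM] at hr₁'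
    exact max_lt (by linarith) (by positivity)
  set y₀ : Kerr.slice 0 r₁ := ⟨y₀E, hmem⟩ with hy₀
  have hy4 : ‖(y₀ : E3)‖ < 4 * M := by
    show ‖y₀E‖ < 4 * M
    rw [hnorm]; linarith
  have key := scalarCurvature_shield_unbent D hMpos hφs hψ hh hy4
  have hn : ‖(y₀ : E3)‖ = 3 * M := hnorm
  rw [hn] at key
  have hval : D.metric.scalarCurvature (φ y₀) = 8 / (225 * M ^ 2) := by
    rw [key]
    field_simp
    ring
  exact ⟨φ y₀, hval, by rw [hval]; positivity⟩

/-- **No datum with `R(h) ≤ 0` everywhere carries a zero-spin shield** — in particular no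
scalar-flat datum (every time-symmetric vacuum datum, every datum with `|k|² = (tr k)²`). -/
theorem not_isKerrShieldedWith_zero_of_scalarCurvature_nonpos [Kerr.Facts] {X : Type}
    [TopologicalSpace X] [ChartedSpace E3 X] [IsManifold (𝓡 3) ∞ X]
    {D : InitialDataSet (𝓡 3) X} [D.metric.HasLeviCivita]
    (hD : ∀ x, D.metric.scalarCurvature x ≤ 0) (M r₁ : ℝ) :
    ¬ IsKerrShieldedWith M 0 r₁ X D := fun h ↦ by
  obtain ⟨x, -, hx⟩ := exists_scalarCurvature_pos_of_isKerrShieldedWith_zero h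
  exact absurd hx (not_lt.2 (hD x))

/-! ## §7  The `c → 0` limit (cycle 2): zero-spin burial families must swell or recede

A *confined* strengthening of the crux refuted. `IsSmoothDataFamily` is local joint smoothness,
so along a burial family `F` through flat data the scalar curvature `R(h_c)(x)` is jointly
CONTINUOUS in `(c, x)` (the tree's Ricci-flow brick `MetricCoord.IsMetricFamilyOn.contDiffOn_scalAt_family`
read through `OpensChart.scalarCurvature_eq_scalAt`, after unpacking the bundle smoothness with
`contMDiffAt_bilin_iff`). By §6 the image `xₙ = φₙ(0,0,3Mₙ)` of the test point of the `n`-th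
shield has `R = 8/(225 Mₙ²)`. Hence: if along `cₙ → 0` the members `F cₙ` carry zero-spin shields
whose near-junction zones `φₙ({‖y‖ < 4Mₙ})` stay in ONE compact set and whose masses stay
bounded, a limit point `x*` would have `R(δ)(x*) ≥ 8/(225 μ²) > 0` — but flat data are scalar
flat. So the horizons of a burial family must SWELL (`Mₙ → ∞`) or RECEDE (leave every compact):
the typed genericity is escaped only at infinity, which is exactly what a topology on data at
`c = 0` (c-uniform compact support, or weighted convergence) would forbid. (The remaining
confined case `Mₙ → ∞` is excluded on paper by area/volume — the zone contains round spheres of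
area `36π Mₙ²` inside a fixed compact set — but needs Riemannian measure theory not attempted
here; conversely UNconfined bounded-mass families DO exist in substance: translate one shielded
datum to infinity at speed `e^{1/c²}`.) -/

section Family

/-- The one-dimensional parameter space `ℝ¹` of the crux. -/
abbrev P1 : Type := EuclideanSpace ℝ (Fin 1)

/-- The unit vector of `ℝ¹`. -/
def e₁ : P1 := EuclideanSpace.single 0 1

theorem eq_smul_e₁ (c : P1) : c = c 0 • e₁ := by
  ext i
  fin_cases i
  simp [e₁]

/-- **Bridge from bundle smoothness to calculus**: along a smooth family of data on a chart
domain `U ⊆ E3`, any representative `G c` of `h_c` is jointly `C^∞` in `(c, y)`. [folklore] -/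
theorem contDiffAt_repr_of_isSmoothDataFamily {U : TopologicalSpace.Opens E3}
    {F : P1 → InitialDataSet 𝓘(ℝ, E3) U} (hF : InitialDataSet.IsSmoothDataFamily 1 F)
    {G : P1 → E3 → E3 →L[ℝ] E3 →L[ℝ] ℝ} (hG : ∀ c (y : U), (F c).h.inner y = G c y)
    (c₀ : P1) (y₀ : U) :
    ContDiffAt ℝ ∞ (Function.uncurry G) (c₀, (y₀ : E3)) := by
  classical
  have h1 := hF.1 (c₀, y₀)
  rw [contMDiffAt_bilin_iff] at h1
  obtain ⟨-, h2⟩ := h1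
  -- the trivialisation of `TU` at `y₀` is the identity on fibres
  have hsymm : ∀ (z : U) (v : E3),
      (trivializationAt E3 (TangentSpace 𝓘(ℝ, E3) : U → Type _) y₀).symmL ℝ z v = v := by
    intro z v
    rw [Trivialization.symmL_apply _ (by simp [OpensChart.chartAt_source])]
    exact OpensChart.trivializationAt_symm_apply y₀ z v
  have hfun : (fun x : P1 × U ↦ (ContinuousLinearMap.precomp ℝ
      ((trivializationAt E3 (TangentSpace 𝓘(ℝ, E3) : U → Type _) y₀).symmL ℝ x.2)).comp
        (((F x.1).h.inner x.2).comp
          ((trivializationAt E3 (TangentSpace 𝓘(ℝ, E3) : U → Type _) y₀).symmL ℝ x.2))) =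
      fun x ↦ G x.1 x.2 := by
    funext x
    ext v w
    simp only [ContinuousLinearMap.comp_apply, ContinuousLinearMap.precomp_apply, hsymm, hG]
    rfl
  rw [hfun] at h2
  -- a local inverse of `Subtype.val` near `y₀`
  set σ : E3 → U := fun z ↦ if hz : z ∈ U then ⟨z, hz⟩ else y₀ with hσdef
  have hσval : ∀ z ∈ (U : Set E3), (σ z : E3) = z := fun z hz ↦ by
    have hz' : z ∈ U := hz
    simp only [hσdef]
    rw [dif_pos hz']
  have hσy₀ : σ y₀ = y₀ := by
    simp only [hσdef]
    rw [dif_pos y₀.2]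
  have hUo : IsOpen ((Set.univ : Set P1) ×ˢ (U : Set E3)) := isOpen_univ.prod U.2
  have hmem : (c₀, (y₀ : E3)) ∈ (Set.univ : Set P1) ×ˢ (U : Set E3) := ⟨trivial, y₀.2⟩
  have hj2 : ContMDiffAt 𝓘(ℝ, P1 × E3) 𝓘(ℝ, E3) ∞ (fun q : P1 × E3 ↦ σ q.2) (c₀, (y₀ : E3)) := by
    rw [← ContMDiffAt.subtypeVal_comp_iff]
    have hev : (Subtype.val ∘ fun q : P1 × E3 ↦ σ q.2) =ᶠ[𝓝 (c₀, (y₀ : E3))] Prod.snd := by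
      filter_upwards [hUo.mem_nhds hmem] with q hq
      exact hσval q.2 hq.2
    exact contDiff_snd.contMDiff.contMDiffAt.congr_of_eventuallyEq hev
  have hj : ContMDiffAt 𝓘(ℝ, P1 × E3) (𝓘(ℝ, P1).prod 𝓘(ℝ, E3)) ∞
      (fun q : P1 × E3 ↦ (q.1, σ q.2)) (c₀, (y₀ : E3)) :=
    contDiff_fst.contMDiff.contMDiffAt.prodMk hj2
  have hcomp : ContMDiffAt 𝓘(ℝ, P1 × E3) 𝓘(ℝ, E3 →L[ℝ] E3 →L[ℝ] ℝ) ∞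
      ((fun x : P1 × U ↦ G x.1 x.2) ∘ fun q : P1 × E3 ↦ (q.1, σ q.2)) (c₀, (y₀ : E3)) :=
    ContMDiffAt.comp_of_eq h2 hj (Prod.ext rfl hσy₀)
  have hev2 : Function.uncurry G =ᶠ[𝓝 (c₀, (y₀ : E3))]
      ((fun x : P1 × U ↦ G x.1 x.2) ∘ fun q : P1 × E3 ↦ (q.1, σ q.2)) := by
    filter_upwards [hUo.mem_nhds hmem] with q hq
    simp only [Function.comp_apply, Function.uncurry, hσval q.2 hq.2]
  exact contMDiffAt_iff_contDiffAt.1 (hcomp.congr_of_eventuallyEq hev2)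

/-- **A smooth family of data on a chart domain is a smooth metric family in coordinates**
(`MetricCoord.IsMetricFamilyOn`, the Ricci-flow layer's notion, along the line `t ↦ t e₁`). -/
theorem isMetricFamilyOn_of_isSmoothDataFamily {U : TopologicalSpace.Opens E3}
    {F : P1 → InitialDataSet 𝓘(ℝ, E3) U} (hF : InitialDataSet.IsSmoothDataFamily 1 F)
    {G : P1 → E3 → E3 →L[ℝ] E3 →L[ℝ] ℝ} (hG : ∀ c (y : U), (F c).h.inner y = G c y) :
    MetricCoord.IsMetricFamilyOn (fun t : ℝ ↦ G (t • e₁)) Set.univ (U : Set E3) where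
  isMetricOn t _ :=
    OpensChart.isMetricOn_repr (g := (F (t • e₁)).metric) (G := G (t • e₁)) fun y ↦ by
      rw [InitialDataSet.val_metric]; exact hG _ y
  contDiffOn := by
    rintro p ⟨hp, -⟩
    have hA := contDiffAt_repr_of_isSmoothDataFamily hF hG (p.2 • e₁) ⟨p.1, hp⟩
    have hB : ContDiffAt ℝ ∞ (fun q : E3 × ℝ ↦ (q.2 • e₁, q.1)) p :=
      ((contDiff_snd.smul contDiff_const).prodMk contDiff_fst).contDiffAt
    exact (hA.comp p hB).contDiffWithinAt
  uniqueDiffOn := uniqueDiffOn_univ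
  subset_closure_interior := by simp

/-- The scalar curvature of the metric of a datum, with its CANONICAL Levi-Civita instance
(`PseudoRiemannianMetric.hasLeviCivita`); equal to `D.metric.scalarCurvature x` under any
instance (proof irrelevance, `scal_eq`). -/
def scal {X : Type} [TopologicalSpace X] [ChartedSpace E3 X] [IsManifold (𝓡 3) ∞ X]
    (D : InitialDataSet (𝓡 3) X) (x : X) : ℝ :=
  haveI := D.metric.hasLeviCivita
  D.metric.scalarCurvature x

theorem scal_eq {X : Type} [TopologicalSpace X] [ChartedSpace E3 X] [IsManifold (𝓡 3) ∞ X]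
    (D : InitialDataSet (𝓡 3) X) [D.metric.HasLeviCivita] (x : X) :
    scal D x = D.metric.scalarCurvature x := rfl

/-- **The scalar curvature is jointly continuous along a smooth family of data on `ℝ³`**:
`(z, t) ↦ R(h_{t e₁})(z)` is continuous on `E3 × ℝ` (data on `Minkowski.slice = ⊤`). -/
theorem continuous_scalarCurvature_family
    {F : P1 → InitialDataSet 𝓘(ℝ, E3) Minkowski.slice}
    (hF : InitialDataSet.IsSmoothDataFamily 1 F) :
    Continuous fun q : E3 × ℝ ↦ scal (F (q.2 • e₁)) ⟨q.1, Minkowski.mem_slice q.1⟩ := by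
  set G : P1 → E3 → E3 →L[ℝ] E3 →L[ℝ] ℝ := fun c z ↦ (F c).h.inner ⟨z, Minkowski.mem_slice z⟩
    with hGdef
  have hG : ∀ c (y : Minkowski.slice), (F c).h.inner y = G c y := fun c y ↦ rfl
  have hfam := isMetricFamilyOn_of_isSmoothDataFamily hF hG
  have hcont : Continuous fun q : E3 × ℝ ↦ MetricCoord.scalAt (G (q.2 • e₁)) q.1 := by
    have h := hfam.contDiffOn_scalAt_family.continuousOn
    have huniv : ((Minkowski.slice : TopologicalSpace.Opens E3) : Set E3) ×ˢ (Set.univ : Set ℝ) =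
        Set.univ := by
      ext q; simp [Minkowski.mem_slice]
    rw [huniv] at h
    exact continuousOn_univ.1 h
  refine hcont.congr fun q ↦ ?_
  haveI := (F (q.2 • e₁)).metric.hasLeviCivita
  rw [scal_eq]
  exact (OpensChart.scalarCurvature_eq_scalAt (g := (F (q.2 • e₁)).metric) (G := G (q.2 • e₁))
    (fun y ↦ by rw [InitialDataSet.val_metric]) ⟨q.1, Minkowski.mem_slice q.1⟩).symm

end Family

/-- The shielding predicate with zero spin, parameters exposed, and the near-junction
(unbent) zone `{‖y‖ < 4M}` CONFINED to the set `C`. -/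
def IsZeroSpinShieldedWithin [Kerr.Facts] (M r₁ : ℝ) (X : Type) [TopologicalSpace X]
    [ChartedSpace E3 X] [IsManifold (𝓡 3) ∞ X] (D : InitialDataSet (𝓡 3) X) (C : Set X) : Prop :=
  ∃ (hM : 0 ≤ M) (T : ℝ → ℝ) (φ : Kerr.slice 0 r₁ → X)
    (ψ : Kerr.slice 0 r₁ → Kerr.region 0 r₁) (ν : NormalField 𝓘(ℝ, E4) ψ),
    |(0:ℝ)| < M ∧ Kerr.rMinus M 0 < r₁ ∧ r₁ < Kerr.rPlus M 0 ∧ T = bentHeight M 0 ∧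
    IsCompact (Set.range φ)ᶜ ∧ Topology.IsOpenEmbedding φ ∧
    ContMDiff 𝓘(ℝ, E3) (𝓡 3) ∞ φ ∧
    (∀ y : Kerr.slice 0 r₁, (ψ y : E4) =
      E4.ofTimeSpace (T (Kerr.radius 0 (E4.ofTimeSpace 0 (y : E3)))) (y : E3)) ∧
    (Kerr.smoothMetric M 0 r₁).IsSpacelikeImmersion 𝓘(ℝ, E3) ψ ∧
    (Kerr.smoothMetric M 0 r₁).IsFutureUnitNormal 𝓘(ℝ, E3)
      ((Kerr.timeOrientation M 0 r₁ hM).ofLE le_top) ψ ν ∧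
    (∀ y : Kerr.slice 0 r₁,
      pullbackBilin (I := 𝓡 3) (I' := 𝓘(ℝ, E3)) φ D.h.inner y =
        pullbackBilin (I := 𝓘(ℝ, E4)) (I' := 𝓘(ℝ, E3)) ψ (Kerr.smoothMetric M 0 r₁).val y) ∧
    (∀ [(Kerr.smoothMetric M 0 r₁).HasLeviCivita] (y : Kerr.slice 0 r₁),
      (pullbackBilin (I := 𝓡 3) (I' := 𝓘(ℝ, E3)) φ D.k y).toLinearMap₁₂ =
        (Kerr.smoothMetric M 0 r₁).secondFundamentalForm 𝓘(ℝ, E3) ψ ν y) ∧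
    (∀ y : Kerr.slice 0 r₁, ‖(y : E3)‖ < 4 * M → φ y ∈ C)

/-- A confined zero-spin shield is a zero-spin shield. -/
theorem IsZeroSpinShieldedWithin.isKerrShieldedWith [Kerr.Facts] {M r₁ : ℝ} {X : Type}
    [TopologicalSpace X] [ChartedSpace E3 X] [IsManifold (𝓡 3) ∞ X]
    {D : InitialDataSet (𝓡 3) X} {C : Set X} (h : IsZeroSpinShieldedWithin M r₁ X D C) :
    IsKerrShieldedWith M 0 r₁ X D := by
  obtain ⟨hM, T, φ, ψ, ν, h1, h2, h3, h4, h5, h6, h7, h8, h9, h10, h11, h12, -⟩ := h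
  exact ⟨hM, T, φ, ψ, ν, h1, h2, h3, h4, h5, h6, h7, h8, h9, h10, h11, h12⟩

/-- A confined zero-spin shield of `D` puts a point with `R(h) = 8/(225M²)` inside `C`. -/
theorem IsZeroSpinShieldedWithin.exists_mem [Kerr.Facts] {M r₁ : ℝ} {X : Type}
    [TopologicalSpace X] [ChartedSpace E3 X] [IsManifold (𝓡 3) ∞ X]
    {D : InitialDataSet (𝓡 3) X} [D.metric.HasLeviCivita] {C : Set X}
    (h : IsZeroSpinShieldedWithin M r₁ X D C) :
    ∃ x ∈ C, D.metric.scalarCurvature x = 8 / (225 * M ^ 2) := by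
  obtain ⟨hM, T, φ, ψ, ν, haM, -, hr₁', hT, -, -, hφs, hψ, -, -, hh, -, hC⟩ := h
  have hMpos : 0 < M := by simpa using haM
  subst hT
  set y₀E : E3 := (3 * M) • EuclideanSpace.single (2 : Fin 3) (1 : ℝ) with hy₀E
  have hnorm : ‖y₀E‖ = 3 * M := by
    rw [hy₀E, norm_smul, PiLp.norm_single, Real.norm_eq_abs, norm_one, mul_one,
      abs_of_pos (by positivity)]
  have hmem : y₀E ∈ Kerr.slice 0 r₁ := by
    rw [Kerr.mem_slice_zero_iff, hnorm]
    have : r₁ < 2 * M := by rwa [Kerr.rPlus_zero_right hM] at hr₁'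
    exact max_lt (by linarith) (by positivity)
  set y₀ : Kerr.slice 0 r₁ := ⟨y₀E, hmem⟩ with hy₀
  have hy4 : ‖(y₀ : E3)‖ < 4 * M := by
    show ‖y₀E‖ < 4 * M
    rw [hnorm]; linarith
  have key := scalarCurvature_shield_unbent D hMpos hφs hψ hh hy4
  have hn : ‖(y₀ : E3)‖ = 3 * M := hnorm
  rw [hn] at key
  refine ⟨φ y₀, hC y₀ hy4, ?_⟩
  rw [key]
  field_simp
  ring

/-- **Core of the `c → 0` argument**: along a smooth family through flat data, no sequence of
members `F cₙ`, `cₙ → 0`, can have points `xₙ` in ONE compact set with scalar curvature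
bounded below by a positive constant. -/
theorem false_of_scal_ge_on_compact
    {F : P1 → InitialDataSet (𝓡 3) Minkowski.slice}
    (hF : InitialDataSet.IsSmoothDataFamily 1 F) (h0 : F 0 = trivialData)
    {c : ℕ → P1} (hc : Tendsto c atTop (𝓝 0))
    {C : Set Minkowski.slice} (hC : IsCompact C) {κ : ℝ} (hκ : 0 < κ)
    {x : ℕ → Minkowski.slice} (hxC : ∀ n, x n ∈ C) (hxR : ∀ n, κ ≤ scal (F (c n)) (x n)) :
    False := by
  set Rf : E3 × ℝ → ℝ := fun q ↦ scal (F (q.2 • e₁)) ⟨q.1, Minkowski.mem_slice q.1⟩ with hRf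
  have hRc : Continuous Rf := continuous_scalarCurvature_family hF
  have hlow : ∀ n, κ ≤ Rf ((x n : E3), c n 0) := by
    intro n
    have hcn : c n 0 • e₁ = c n := (eq_smul_e₁ (c n)).symm
    simp only [hRf]
    rw [hcn]
    exact hxR n
  obtain ⟨xs, hxs, κ', hκ', hlim⟩ := hC.tendsto_subseq hxC
  have hlim' : Tendsto (fun k ↦ ((x (κ' k) : E3), c (κ' k) 0)) atTop (𝓝 ((xs : E3), 0)) := by
    refine Tendsto.prodMk_nhds ?_ ?_
    · exact (continuous_subtype_val.tendsto xs).comp hlim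
    · have h0c : Tendsto (fun n ↦ c n 0) atTop (𝓝 ((0 : P1) 0)) :=
        ((EuclideanSpace.proj (0 : Fin 1)).continuous.tendsto (0 : P1)).comp hc
      exact h0c.comp hκ'.tendsto_atTop
  have hRlim : Tendsto (fun k ↦ Rf ((x (κ' k) : E3), c (κ' k) 0)) atTop (𝓝 (Rf ((xs : E3), 0))) :=
    (hRc.tendsto _).comp hlim'
  have hR0 : Rf ((xs : E3), 0) = 0 := by
    simp only [hRf, zero_smul]
    rw [h0]
    haveI := trivialData.metric.hasLeviCivita
    exact trivialData_scalarCurvature_eq_zero _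
  rw [hR0] at hRlim
  have hge : κ ≤ 0 := ge_of_tendsto hRlim (Eventually.of_forall fun k ↦ hlow (κ' k))
  exact absurd hge (not_le.2 hκ)

/-- A confined zero-spin shield of `D` with junction radius `r₁` puts a point with
`R(h) ≥ 1/(2(r₁+1)²)` inside `C`: the image of the point at Kerr–Schild radius
`r = r₁ + min 1 ((2M − r₁)/2)` (inside the horizon, `r < 2M`, where
`R = 8M²/(r²(r+2M)²) ≥ 1/(2r²)`). -/
theorem IsZeroSpinShieldedWithin.exists_mem_ge [Kerr.Facts] {M r₁ : ℝ} {X : Type}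
    [TopologicalSpace X] [ChartedSpace E3 X] [IsManifold (𝓡 3) ∞ X]
    {D : InitialDataSet (𝓡 3) X} [D.metric.HasLeviCivita] {C : Set X}
    (h : IsZeroSpinShieldedWithin M r₁ X D C) :
    ∃ x ∈ C, 1 / (2 * (r₁ + 1) ^ 2) ≤ D.metric.scalarCurvature x := by
  have hr₁pos : 0 < r₁ := h.isKerrShieldedWith.r₁_pos
  obtain ⟨hM, T, φ, ψ, ν, haM, -, hr₁', hT, -, -, hφs, hψ, -, -, hh, -, hC⟩ := h
  have hMpos : 0 < M := by simpa using haM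
  have hr₁M : r₁ < 2 * M := by rwa [Kerr.rPlus_zero_right hM] at hr₁'
  subst hT
  -- the test radius
  set δ : ℝ := min 1 ((2 * M - r₁) / 2) with hδ
  have hδpos : 0 < δ := lt_min one_pos (by linarith)
  have hδ1 : δ ≤ 1 := min_le_left _ _
  have hδ2 : δ ≤ (2 * M - r₁) / 2 := min_le_right _ _
  set r : ℝ := r₁ + δ with hr
  have hrpos : 0 < r := by positivity
  have hr2M : r < 2 * M := by linarith
  set yE : E3 := r • EuclideanSpace.single (2 : Fin 3) (1 : ℝ) with hyE
  have hnorm : ‖yE‖ = r := by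
    rw [hyE, norm_smul, PiLp.norm_single, Real.norm_eq_abs, norm_one, mul_one, abs_of_pos hrpos]
  have hmem : yE ∈ Kerr.slice 0 r₁ := by
    rw [Kerr.mem_slice_zero_iff, hnorm]
    exact max_lt (by linarith) hrpos
  set y : Kerr.slice 0 r₁ := ⟨yE, hmem⟩ with hy
  have hy4 : ‖(y : E3)‖ < 4 * M := by
    show ‖yE‖ < 4 * M
    rw [hnorm]; linarith
  have key := scalarCurvature_shield_unbent D hMpos hφs hψ hh hy4
  have hn : ‖(y : E3)‖ = r := hnorm
  rw [hn] at key
  refine ⟨φ y, hC y hy4, ?_⟩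
  rw [key]
  -- `1/(2(r₁+1)²) ≤ 8M²/(r²(r+2M)²)`
  have h1 : r ^ 2 ≤ (r₁ + 1) ^ 2 := by nlinarith
  have h2 : (r + 2 * M) ^ 2 ≤ 16 * M ^ 2 := by nlinarith
  have h3 : r ^ 2 * (r + 2 * M) ^ 2 ≤ (r₁ + 1) ^ 2 * (16 * M ^ 2) :=
    mul_le_mul h1 h2 (by positivity) (by positivity)
  rw [div_le_div_iff₀ (by positivity) (by positivity)]
  nlinarith [h3]

/-- **Zero-spin burial families must swell or recede — sharp form with JUNCTION RADII**: along
`cₙ → 0` the members of a smooth family through flat data cannot carry zero-spin shields with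
bounded junction radii `r₁(n) ≤ ρ` whose near-junction zones stay in one compact set. (Bounded
masses imply bounded junction radii, `r₁ < 2M`; so either the junction spheres' Kerr–Schild
radii — and a fortiori the masses — blow up inside a bounded region, absurd by area on paper,
or the zones leave every compact set.) -/
theorem not_confined_zeroSpin_burial_of_radius_le [Kerr.Facts]
    {F : P1 → InitialDataSet (𝓡 3) Minkowski.slice}
    (hF : InitialDataSet.IsSmoothDataFamily 1 F) (h0 : F 0 = trivialData)
    {c : ℕ → P1} (hc : Tendsto c atTop (𝓝 0)) {M r₁ : ℕ → ℝ}
    {C : Set Minkowski.slice} (hC : IsCompact C) {ρ : ℝ} (hρ : ∀ n, r₁ n ≤ ρ)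
    (hS : ∀ n, IsZeroSpinShieldedWithin (M n) (r₁ n) Minkowski.slice (F (c n)) C) : False := by
  have hx : ∀ n, ∃ x ∈ C, 1 / (2 * (ρ + 1) ^ 2) ≤ scal (F (c n)) x := by
    intro n
    haveI := (F (c n)).metric.hasLeviCivita
    obtain ⟨x, hxC, hR⟩ := (hS n).exists_mem_ge
    refine ⟨x, hxC, le_trans ?_ hR⟩
    have hr₁pos : 0 < r₁ n := (hS n).isKerrShieldedWith.r₁_pos
    have h4 : 0 < 2 * (r₁ n + 1) ^ 2 := by positivity
    exact div_le_div_of_nonneg_left zero_le_one h4 (by nlinarith [hρ n])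
  choose x hxC hxR using hx
  have hρpos : 0 < ρ + 1 := by
    have := (hS 0).isKerrShieldedWith.r₁_pos
    linarith [hρ 0]
  exact false_of_scal_ge_on_compact hF h0 hc hC (by positivity) hxC hxR

/-- **Zero-spin burial families must swell or recede** (a CONFINED strengthening of the crux
refuted at flat data). Let `F` be a smooth one-parameter family of data on `ℝ³` with
`F 0 = trivialData`, let `cₙ → 0`, and suppose each `F cₙ` carries a zero-spin shield of mass
`Mₙ ≤ μ` whose near-junction zone `φₙ({‖y‖ < 4Mₙ})` lies in a FIXED compact set `C`. Then
`False` (bounded masses give bounded junction radii `r₁ < 2M ≤ 2μ`;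
`not_confined_zeroSpin_burial_of_radius_le`). -/
theorem not_confined_zeroSpin_burial [Kerr.Facts]
    {F : P1 → InitialDataSet (𝓡 3) Minkowski.slice}
    (hF : InitialDataSet.IsSmoothDataFamily 1 F) (h0 : F 0 = trivialData)
    {c : ℕ → P1} (hc : Tendsto c atTop (𝓝 0)) {M r₁ : ℕ → ℝ}
    {C : Set Minkowski.slice} (hC : IsCompact C) {μ : ℝ} (hμ : ∀ n, M n ≤ μ)
    (hS : ∀ n, IsZeroSpinShieldedWithin (M n) (r₁ n) Minkowski.slice (F (c n)) C) : False :=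
  not_confined_zeroSpin_burial_of_radius_le hF h0 hc hC (ρ := 2 * μ)
    (fun n ↦ by have := (hS n).isKerrShieldedWith.r₁_lt_two_mul; linarith [hμ n]) hS


/-! ## §8  GENERAL-SPIN teeth (cycle 3): every Kerr shield, of ANY sub-extremal spin, has
`k ≠ 0` at the axis point `(0, 0, 3M)`; the guard `c ≠ 0` of the crux is load-bearing

Cycles 1–2 read the shield only for ZERO spin (closed forms `hRep`/`kRep` of the Schwarzschild
Kerr–Schild slice). For `a ≠ 0` the tree has no closed form of the slice data, but ON THE ROTATION
AXIS everything is explicit: at `x = (t; 0, 0, u)`, `u > 0`, the Kerr–Schild radius is `r = u`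
(`radius_axisPt`, via `Kerr.radius_eq_of_quartic`), `ℓ = dt* + dz =: ℓ₀` is CONSTANT along the
axis (`nullCovector_axisPt`), `H = H_ax(u) = M u/(u² + a²)` (`scalarH_axisPt`), hence
`g = η + 2H_ax(u) ℓ₀ ⊗ ℓ₀` (`bilin_axisPt`), `∂_z g = 2H_ax′(u) ℓ₀ ⊗ ℓ₀` (`fderiv_bilin_axis_Z`,
line derivative along the axis + uniqueness) and `∂_{t*} g = 0` (stationarity, tree). The future
unit normal of the slice is forced for every spin (`eq_normalRepA`: `ν = V/√(1 + 2H)`, linear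
algebra with `g(V, ·) = −dt*` and `g|_{slice} = δ + 2H ℓ⃗⊗ℓ⃗ ≥ δ`), the normal-derivative term of
the second fundamental form is eliminated by differentiating the normality relation
(`bilin_fderiv_normalRepA`), and the Koszul form collapses at the axis point to the CLOSED FORM
(`sffA_axisPt`, `k_pullback_axisPt`):

  `k_{φ y₀}(dφ e_z, dφ e_z) = K(e_z, e_z)(0;0,0,u) = −2 H_ax′(u) (1 + H_ax(u)) / √(1 + 2H_ax(u))`,

which at `u = 3M` is `> 0` for all `|a| < M` (`H_ax′(3M) = M(a² − 9M²)/(9M² + a²)² < 0`;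
`axisTooth_pos`; for `a = 0` it is Cook's `kRep` radial value `2M(1 + M/r)/(r²√(1 + 2M/r))`).
Consequences, now for the FULL typed predicate (any spin):
* `exists_k_ne_zero_of_isKerrShieldedWith` — every shield forces `k ≢ 0`;
* `not_isKerrShieldedWith_of_isTimeSymmetric`, `not_isKerrShielded_of_isTimeSymmetric` — no
  time-symmetric datum (flat, Schwarzschild/Brill–Lindquist/Misner slices, …) is Kerr-shielded;
* **LOAD-BEARING `c ≠ 0`**: `parametricKerrBurial_false_without_ne_zero` — the crux with the
  guard `c ≠ 0` dropped (every member shielded, including `F 0 = d`) is FALSE at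
  `d = trivialData`; any proof must use the exception at `c = 0` (the datum itself is in general
  unshieldable, so the family must genuinely MOVE away from `d`);
* `not_forall_admissible_isKerrShielded` — "every admissible datum is itself shielded"
  (constant families) is false for every spin, closing the zero-spin-only gap of §5. -/

/-- The spatial unit vector `e_z ∈ E3`. -/
def ez : E3 := EuclideanSpace.single (2 : Fin 3) (1 : ℝ)

/-- The axis point `(0, 0, u) ∈ E3`. -/
def axisPt (u : ℝ) : E3 := u • ez

theorem axisPt_apply (u : ℝ) (i : Fin 3) : axisPt u i = if i = 2 then u else 0 := by
  fin_cases i <;> simp [axisPt, ez]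

theorem norm_axisPt {u : ℝ} (hu : 0 ≤ u) : ‖axisPt u‖ = u := by
  rw [axisPt, ez, norm_smul, PiLp.norm_single, Real.norm_eq_abs, norm_one, mul_one,
    abs_of_nonneg hu]

theorem ofTimeSpace_axisPt_apply_one (t u : ℝ) : E4.ofTimeSpace t (axisPt u) 1 = 0 := by
  show E4.ofTimeSpace t (axisPt u) (Fin.succ 0) = 0
  rw [E4.ofTimeSpace_apply_succ, axisPt_apply]; simp

theorem ofTimeSpace_axisPt_apply_two (t u : ℝ) : E4.ofTimeSpace t (axisPt u) 2 = 0 := by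
  show E4.ofTimeSpace t (axisPt u) (Fin.succ 1) = 0
  rw [E4.ofTimeSpace_apply_succ, axisPt_apply]; simp

theorem ofTimeSpace_axisPt_apply_three (t u : ℝ) : E4.ofTimeSpace t (axisPt u) 3 = u := by
  show E4.ofTimeSpace t (axisPt u) (Fin.succ 2) = u
  rw [E4.ofTimeSpace_apply_succ, axisPt_apply]; simp

/-- **On the axis the Kerr–Schild radius is `|z|`**: `r(a, (t; 0, 0, u)) = u` for `u > 0`
(the defining quartic factors as `(r² − u²)(r² + a²)`). [folklore] -/
theorem radius_axisPt (a t : ℝ) {u : ℝ} (hu : 0 < u) :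
    Kerr.radius a (E4.ofTimeSpace t (axisPt u)) = u := by
  apply Kerr.radius_eq_of_quartic hu
  rw [E4.spatialNorm_ofTimeSpace, norm_axisPt hu.le, ofTimeSpace_axisPt_apply_three]
  ring

/-- `H = M u/(u² + a²)` at the axis point `(t; 0, 0, u)`, `u > 0`. [folklore] -/
theorem scalarH_axisPt (M a t : ℝ) {u : ℝ} (hu : 0 < u) :
    Kerr.scalarH M a (E4.ofTimeSpace t (axisPt u)) = M * u / (u ^ 2 + a ^ 2) := by
  rw [Kerr.scalarH, radius_axisPt a t hu, ofTimeSpace_axisPt_apply_three]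
  have h1 : u ^ 4 + a ^ 2 * u ^ 2 = u ^ 2 * (u ^ 2 + a ^ 2) := by ring
  have hu' : u ≠ 0 := hu.ne'
  have h2 : u ^ 2 + a ^ 2 ≠ 0 := by positivity
  rw [h1]
  field_simp

/-- The constant axis covector `ℓ₀ = dt* + dz`. -/
def ell0 : E4 →L[ℝ] ℝ := E4.covector ![1, 0, 0, 1]

theorem ell0_apply (v : E4) : ell0 v = v 0 + v 3 := by
  simp [ell0, E4.covector_apply, Fin.sum_univ_four]

/-- `ℓ = (1, 0, 0, 1)` at the axis point. [folklore] -/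
theorem nullCovectorFun_axisPt (a t : ℝ) {u : ℝ} (hu : 0 < u) :
    Kerr.nullCovectorFun a (E4.ofTimeSpace t (axisPt u)) = ![1, 0, 0, 1] := by
  rw [Kerr.nullCovectorFun, radius_axisPt a t hu, ofTimeSpace_axisPt_apply_one,
    ofTimeSpace_axisPt_apply_two, ofTimeSpace_axisPt_apply_three]
  have hu' : u ≠ 0 := hu.ne'
  ext i
  fin_cases i <;> simp [hu']

theorem nullCovector_axisPt (a t : ℝ) {u : ℝ} (hu : 0 < u) :
    Kerr.nullCovector a (E4.ofTimeSpace t (axisPt u)) = ell0 := by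
  rw [Kerr.nullCovector, nullCovectorFun_axisPt a t hu]
  rfl

/-- `ℓ♯ = −∂_{t*} + ∂_z` at the axis point. [folklore] -/
theorem nullVector_axisPt (a t : ℝ) {u : ℝ} (hu : 0 < u) :
    Kerr.nullVector a (E4.ofTimeSpace t (axisPt u)) = -E4.basisVector 0 + E4.basisVector 3 := by
  ext μ
  rw [Kerr.nullVector_apply, nullCovectorFun_axisPt a t hu]
  fin_cases μ <;> simp [E4.basisVector]

/-- The axis profile `H_ax(u) = M u/(u² + a²)` of the Kerr–Schild scalar and its derivative. -/
def Hax (M a : ℝ) (u : ℝ) : ℝ := M * u / (u ^ 2 + a ^ 2)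

/-- `H_ax′(u) = M (a² − u²)/(u² + a²)²`. -/
def dHax (M a u : ℝ) : ℝ := M * (a ^ 2 - u ^ 2) / (u ^ 2 + a ^ 2) ^ 2

theorem hasDerivAt_Hax (M a : ℝ) {u : ℝ} (hu : 0 < u) : HasDerivAt (Hax M a) (dHax M a u) u := by
  have h1 : HasDerivAt (fun u : ℝ ↦ M * u) M u := by
    simpa using (hasDerivAt_id u).const_mul M
  have h2 : HasDerivAt (fun u : ℝ ↦ u ^ 2 + a ^ 2) (2 * u) u := by
    simpa using (hasDerivAt_pow 2 u).add_const (a ^ 2)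
  have hne : u ^ 2 + a ^ 2 ≠ 0 := by positivity
  have h := h1.div h2 hne
  have heq : dHax M a u = (M * (u ^ 2 + a ^ 2) - M * u * (2 * u)) / (u ^ 2 + a ^ 2) ^ 2 := by
    unfold dHax
    congr 1
    ring
  rw [heq]
  exact h

/-- The metric components at the axis point: `g = η + 2 H_ax(u) ℓ₀ ⊗ ℓ₀`. [folklore] -/
theorem bilin_axisPt (M a t : ℝ) {u : ℝ} (hu : 0 < u) :
    Kerr.bilin M a (E4.ofTimeSpace t (axisPt u)) =
      Minkowski.bilin + (2 * Hax M a u) • E4.tmul ell0 ell0 := by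
  rw [Kerr.bilin, scalarH_axisPt M a t hu, nullCovector_axisPt a t hu]
  rfl

/-- `V = (1 + 2H) ∂_{t*} − 2H ∂_z` at the axis point. [folklore] -/
theorem timeVector_axisPt (M a t : ℝ) {u : ℝ} (hu : 0 < u) :
    Kerr.timeVector M a (E4.ofTimeSpace t (axisPt u)) =
      (1 + 2 * Hax M a u) • E4.basisVector 0 - (2 * Hax M a u) • E4.basisVector 3 := by
  rw [Kerr.timeVector, nullVector_axisPt a t hu, scalarH_axisPt M a t hu, Hax]
  module

/-- The axis line through `(0; 0, 0, u₀)` in the direction `∂_z`. [folklore] -/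
theorem axis_line (u₀ s : ℝ) :
    E4.ofTimeSpace 0 (axisPt u₀) + s • E4.basisVector 3 = E4.ofTimeSpace 0 (axisPt (u₀ + s)) := by
  ext μ
  refine Fin.cases ?_ (fun j ↦ ?_) μ
  · simp [E4.basisVector]
  · rw [PiLp.add_apply, PiLp.smul_apply, E4.ofTimeSpace_apply_succ, E4.ofTimeSpace_apply_succ,
      axisPt_apply, axisPt_apply]
    fin_cases j <;> simp [E4.basisVector, Fin.succ]

/-- `(0, e_z) = ∂_z`. [folklore] -/
theorem ofTimeSpace_ez : E4.ofTimeSpace 0 ez = E4.basisVector 3 := by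
  ext μ
  refine Fin.cases ?_ (fun j ↦ ?_) μ
  · simp [E4.basisVector]
  · rw [E4.ofTimeSpace_apply_succ]
    fin_cases j <;> simp [ez, E4.basisVector, Fin.succ]

/-- **`∂_z g` on the axis**: `DG_{(0;0,0,u₀)}(∂_z) = 2 H_ax′(u₀) ℓ₀ ⊗ ℓ₀` — along the axis
`ℓ ≡ ℓ₀` is constant and `H = H_ax(z)`. [folklore] -/
theorem fderiv_bilin_axis_Z (M a : ℝ) {u₀ : ℝ} (hu₀ : 0 < u₀) :
    fderiv ℝ (Kerr.bilin M a) (E4.ofTimeSpace 0 (axisPt u₀)) (E4.basisVector 3) =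
      (2 * dHax M a u₀) • E4.tmul ell0 ell0 := by
  set p := E4.ofTimeSpace 0 (axisPt u₀) with hp
  have hr : 0 < Kerr.radius a p := by rw [hp, radius_axisPt a 0 hu₀]; exact hu₀
  have hd : DifferentiableAt ℝ (Kerr.bilin M a) p :=
    (Kerr.contDiffAt_bilin M a hr (n := 1)).differentiableAt one_ne_zero
  have h1 : HasLineDerivAt ℝ (Kerr.bilin M a) (fderiv ℝ (Kerr.bilin M a) p (E4.basisVector 3)) p
      (E4.basisVector 3) :=
    hd.hasFDerivAt.hasLineDerivAt _
  have h2 : HasLineDerivAt ℝ (Kerr.bilin M a) ((2 * dHax M a u₀) • E4.tmul ell0 ell0) p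
      (E4.basisVector 3) := by
    show HasDerivAt (fun s : ℝ ↦ Kerr.bilin M a (p + s • E4.basisVector 3)) _ 0
    have hev : (fun s : ℝ ↦ Kerr.bilin M a (p + s • E4.basisVector 3)) =ᶠ[𝓝 0]
        fun s ↦ Minkowski.bilin + (2 * Hax M a (u₀ + s)) • E4.tmul ell0 ell0 := by
      have hpos : ∀ᶠ s : ℝ in 𝓝 0, -u₀ < s := eventually_gt_nhds (by linarith)
      filter_upwards [hpos] with s hs
      have hs' : 0 < u₀ + s := by linarith
      rw [hp, axis_line, bilin_axisPt M a 0 hs']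
    have hH : HasDerivAt (fun s : ℝ ↦ Hax M a (u₀ + s)) (dHax M a u₀) 0 := by
      have e : u₀ + 0 = u₀ := add_zero u₀
      have h := (hasDerivAt_Hax M a (u := u₀ + 0) (by rw [e]; exact hu₀)).comp_const_add u₀ 0
      rw [e] at h
      exact h
    have h3 : HasDerivAt (fun s : ℝ ↦ Minkowski.bilin + (2 * Hax M a (u₀ + s)) • E4.tmul ell0 ell0)
        ((2 * dHax M a u₀) • E4.tmul ell0 ell0) 0 := by
      have := ((hH.const_mul 2).smul_const (E4.tmul ell0 ell0)).const_add Minkowski.bilin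
      simpa using this
    exact h3.congr_of_eventuallyEq hev
  exact h1.unique h2

/-- **`∂_{t*} g = 0`** at the axis point (stationarity, tree lemma). -/
theorem fderiv_bilin_axis_zero (M a : ℝ) {u₀ : ℝ} (hu₀ : 0 < u₀) :
    fderiv ℝ (Kerr.bilin M a) (E4.ofTimeSpace 0 (axisPt u₀)) (E4.basisVector 0) = 0 := by
  have hr : 0 < Kerr.radius a (E4.ofTimeSpace 0 (axisPt u₀)) := by
    rw [radius_axisPt a 0 hu₀]; exact hu₀
  exact Kerr.fderiv_bilin_basisVector_zero M a
    ((Kerr.contDiffAt_bilin M a hr (n := 1)).differentiableAt one_ne_zero)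


/-! ### The future unit normal of the Kerr–Schild slice `{t* = 0}`, general spin -/

/-- The representative `N(y) = (1 + 2H)^{-1/2} V(0, y)` of the future unit normal of the slice
`{t* = 0}` of Kerr `(M, a)` in ingoing Kerr–Schild coordinates (Cook 2000, §3.2.2: lapse
`α = (1 + 2H)^{-1/2}`, shift `βⁱ = 2Hℓⁱ/(1 + 2H)`). -/
def normalRepA (M a : ℝ) (y : E3) : E4 :=
  (√(1 + 2 * Kerr.scalarH M a (E4.ofTimeSpace 0 y)))⁻¹ • Kerr.timeVector M a (E4.ofTimeSpace 0 y)

/-- **Uniqueness of the future unit normal (any spin)**: at a point `x = (0, y)` with `r > 0`, a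
vector `n` which is `g`-orthogonal to the slice directions `(0, w)`, unit timelike and in the
future cone of `V = −g♯dt*` IS `V/√(1 + 2H)`. Linear algebra: `n = αV + B` with `B` spatial,
`g(B, B) = g(n − αV, B) = 0`, and `g` is positive definite on spatial vectors
(`|B⃗|² + 2Hℓ(B)²`), so `B = 0`; unit length and the future condition pin `α`. [folklore] -/
theorem eq_normalRepA {M a : ℝ} (hM : 0 ≤ M) {y : E3}
    (hx : 0 < Kerr.radius a (E4.ofTimeSpace 0 y)) {n : E4}
    (hn : ∀ w : E3, Kerr.bilin M a (E4.ofTimeSpace 0 y) n (E4.ofTimeSpace 0 w) = 0)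
    (hu : Kerr.bilin M a (E4.ofTimeSpace 0 y) n n = -1)
    (hf : Kerr.bilin M a (E4.ofTimeSpace 0 y) (Kerr.timeVector M a (E4.ofTimeSpace 0 y)) n < 0) :
    n = normalRepA M a y := by
  set x : E4 := E4.ofTimeSpace 0 y with hxdef
  set H : ℝ := Kerr.scalarH M a x with hHdef
  set V : E4 := Kerr.timeVector M a x with hVdef
  have hH : 0 ≤ H := Kerr.scalarH_nonneg hM a x
  have hV1 : ∀ w : E4, Kerr.bilin M a x V w = -w 0 := fun w ↦ Kerr.bilin_timeVector hx w
  have hV2 : Kerr.bilin M a x V V = -1 - 2 * H := Kerr.bilin_timeVector_timeVector hx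
  have hV0 : V 0 = 1 + 2 * H := by have := hV1 V; rw [hV2] at this; linarith
  have h12 : (0 : ℝ) < 1 + 2 * H := by positivity
  set α : ℝ := n 0 / (1 + 2 * H) with hαdef
  set B : E4 := n - α • V with hBdef
  have hB0 : B 0 = 0 := by
    simp only [hBdef, PiLp.sub_apply, PiLp.smul_apply, smul_eq_mul, hV0, hαdef]
    field_simp
    ring
  have hB : E4.ofTimeSpace 0 (E4.spatial B) = B := by
    have := E4.ofTimeSpace_time_spatial B
    rwa [E4.time_apply, hB0] at this
  -- `g(B, B) = 0`
  have hnB : Kerr.bilin M a x n B = 0 := by rw [← hB]; exact hn _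
  have hVB : Kerr.bilin M a x V B = 0 := by rw [hV1, hB0, neg_zero]
  have hBB : Kerr.bilin M a x B B = 0 := by
    have e : Kerr.bilin M a x (n - α • V) B = 0 := by
      have h1 : Kerr.bilin M a x (n - α • V) B =
          Kerr.bilin M a x n B - α * Kerr.bilin M a x V B := by
        simp only [map_sub, map_smul]
        rfl
      rw [h1, hnB, hVB]; ring
    rwa [← hBdef] at e
  -- positivity of `g` on the slice directions forces `B = 0`
  have hsum : ∑ i : Fin 3, B i.succ * B i.succ +
      2 * H * (Kerr.nullCovector a x B * Kerr.nullCovector a x B) = 0 := by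
    rw [Kerr.bilin_apply, Minkowski.bilin_apply, hB0] at hBB
    simpa using hBB
  have hsq : ∑ i : Fin 3, B i.succ * B i.succ = 0 := by
    have h1 : 0 ≤ ∑ i : Fin 3, B i.succ * B i.succ :=
      Finset.sum_nonneg fun i _ ↦ mul_self_nonneg _
    have h2 : 0 ≤ 2 * H * (Kerr.nullCovector a x B * Kerr.nullCovector a x B) := by
      have := mul_self_nonneg (Kerr.nullCovector a x B)
      positivity
    linarith
  have hBi : ∀ i : Fin 3, B i.succ = 0 := fun i ↦ by
    have := (Finset.sum_eq_zero_iff_of_nonneg (fun j _ ↦ mul_self_nonneg (B (Fin.succ j)))).1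
      hsq i (Finset.mem_univ i)
    exact mul_self_eq_zero.1 this
  have hBzero : B = 0 := by
    ext μ
    refine Fin.cases ?_ (fun j ↦ ?_) μ
    · simpa using hB0
    · simpa using hBi j
  have hnV : n = α • V := by
    have : n - α • V = 0 := hBzero
    exact sub_eq_zero.1 this
  -- unit length and future direction pin `α`
  have hαsq : α ^ 2 * (1 + 2 * H) = 1 := by
    rw [hnV] at hu
    simp only [map_smul, FunLike.coe_smul, Pi.smul_apply, smul_eq_mul, hV2] at hu
    nlinarith [hu]
  have hαpos : 0 < α := by
    rw [hnV] at hf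
    simp only [map_smul, smul_eq_mul, hV2] at hf
    nlinarith [hf, h12]
  have hα : α = (√(1 + 2 * H))⁻¹ := by
    rw [← Real.sqrt_inv]
    have : (1 + 2 * H)⁻¹ = α ^ 2 := by
      rw [eq_comm, ← one_div, eq_div_iff h12.ne']
      exact hαsq
    rw [this, Real.sqrt_sq hαpos.le]
  rw [hnV, hα]
  rfl

/-- **Normality**: `g(N(y), (0, w)) = 0` at `(0, y)` (`g(V, ·) = −dt*`). [folklore] -/
theorem bilin_normalRepA_ofTimeSpace (M a : ℝ) {y : E3}
    (hx : 0 < Kerr.radius a (E4.ofTimeSpace 0 y)) (w : E3) :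
    Kerr.bilin M a (E4.ofTimeSpace 0 y) (normalRepA M a y) (E4.ofTimeSpace 0 w) = 0 := by
  rw [normalRepA, map_smul, FunLike.coe_smul, Pi.smul_apply, Kerr.bilin_timeVector hx,
    E4.ofTimeSpace_apply_zero, neg_zero, smul_zero]

/-- The unit normal representative is differentiable at the points of the slice (`M ≥ 0`). -/
theorem differentiableAt_normalRepA {M a : ℝ} (hM : 0 ≤ M) {y : E3}
    (hx : 0 < Kerr.radius a (E4.ofTimeSpace 0 y)) :
    DifferentiableAt ℝ (normalRepA M a) y := by
  have he : ContDiff ℝ 1 (E4.ofTimeSpace 0) :=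
    contMDiff_iff_contDiff.1 (E4.contMDiff_ofTimeSpace 0 1)
  have hH : ContDiffAt ℝ 1 (fun y : E3 ↦ Kerr.scalarH M a (E4.ofTimeSpace 0 y)) y :=
    (Kerr.contDiffAt_scalarH M a hx).comp y he.contDiffAt
  have hV : ContDiffAt ℝ 1 (fun y : E3 ↦ Kerr.timeVector M a (E4.ofTimeSpace 0 y)) y :=
    (Kerr.contDiffAt_timeVector M a hx).comp y he.contDiffAt
  have hpos' : 0 < 1 + 2 * Kerr.scalarH M a (E4.ofTimeSpace 0 y) := by
    have := Kerr.scalarH_nonneg hM a (E4.ofTimeSpace 0 y); positivity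
  have hs : ContDiffAt ℝ 1
      (fun y : E3 ↦ (√(1 + 2 * Kerr.scalarH M a (E4.ofTimeSpace 0 y)))⁻¹) y := by
    refine ((contDiffAt_const.add (contDiffAt_const.mul hH)).sqrt hpos'.ne').inv ?_
    exact (Real.sqrt_pos.2 hpos').ne'
  exact (hs.smul hV).differentiableAt one_ne_zero

/-- **The derivative of the normality relation along the slice (any spin)**:
`g(DN(y) v, (0, w)) = −(∂_{(0,v)} g)(N(y), (0, w))` at `(0, y)` — differentiate
`y ↦ g_{(0,y)}(N(y), (0, w)) ≡ 0` (O'Neill 1983, Ch. 4, proof of Lemma 4.4). [folklore] -/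
theorem bilin_fderiv_normalRepA {M a : ℝ} (hM : 0 ≤ M) {y : E3}
    (hx : 0 < Kerr.radius a (E4.ofTimeSpace 0 y)) (v w : E3) :
    Kerr.bilin M a (E4.ofTimeSpace 0 y) (fderiv ℝ (normalRepA M a) y v) (E4.ofTimeSpace 0 w) =
      -fderiv ℝ (Kerr.bilin M a) (E4.ofTimeSpace 0 y) (E4.ofTimeSpace 0 v) (normalRepA M a y)
        (E4.ofTimeSpace 0 w) := by
  -- the function `y' ↦ g_{(0,y')}(N y', (0,w))` vanishes near `y`
  have ho : IsOpen {y' : E3 | 0 < Kerr.radius a (E4.ofTimeSpace 0 y')} :=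
    isOpen_lt continuous_const ((Kerr.continuous_radius a).comp (E4.continuous_ofTimeSpace 0))
  have hzero : (fun y' : E3 ↦ Kerr.bilin M a (E4.ofTimeSpace 0 y') (normalRepA M a y')
      (E4.ofTimeSpace 0 w)) =ᶠ[𝓝 y] fun _ ↦ 0 := by
    filter_upwards [ho.mem_nhds hx] with y' hy'
    exact bilin_normalRepA_ofTimeSpace M a hy' w
  have h0 : HasFDerivAt (fun y' : E3 ↦ Kerr.bilin M a (E4.ofTimeSpace 0 y') (normalRepA M a y')
      (E4.ofTimeSpace 0 w)) (0 : E3 →L[ℝ] ℝ) y :=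
    (hasFDerivAt_const (0 : ℝ) y).congr_of_eventuallyEq hzero
  -- and its derivative by the product rule
  have hGd : DifferentiableAt ℝ (Kerr.bilin M a) (E4.ofTimeSpace 0 y) :=
    (Kerr.contDiffAt_bilin M a hx (n := 1)).differentiableAt one_ne_zero
  have hB : HasFDerivAt (fun y' : E3 ↦ Kerr.bilin M a (E4.ofTimeSpace 0 y'))
      ((fderiv ℝ (Kerr.bilin M a) (E4.ofTimeSpace 0 y)).comp Kerr.sliceEmbedCLM) y :=
    hGd.hasFDerivAt.comp y (Kerr.hasFDerivAt_ofTimeSpace_zero y)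
  have hN := (differentiableAt_normalRepA hM hx).hasFDerivAt
  have h1 := (hB.clm_apply hN).clm_apply (hasFDerivAt_const (E4.ofTimeSpace 0 w) y)
  have huniq := h0.unique h1
  have key := DFunLike.congr_fun huniq v
  simp only [zero_apply, _root_.add_apply,
    ContinuousLinearMap.comp_apply, ContinuousLinearMap.flip_apply, Kerr.sliceEmbedCLM_apply,
    map_zero, zero_add] at key
  linarith

/-- At the axis point: `N = √(1 + 2H)⁻¹ ((1 + 2H) ∂_{t*} − 2H ∂_z)`, `H = H_ax(u)`. -/
theorem normalRepA_axisPt (M a : ℝ) {u : ℝ} (hu : 0 < u) :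
    normalRepA M a (axisPt u) = (√(1 + 2 * Hax M a u))⁻¹ •
      ((1 + 2 * Hax M a u) • E4.basisVector 0 - (2 * Hax M a u) • E4.basisVector 3) := by
  rw [normalRepA, timeVector_axisPt M a 0 hu, scalarH_axisPt M a 0 hu, Hax]


theorem ell0_basisVector_zero : ell0 (E4.basisVector 0) = 1 := by
  rw [ell0_apply]; simp [E4.basisVector]

theorem ell0_basisVector_three : ell0 (E4.basisVector 3) = 1 := by
  rw [ell0_apply]; simp [E4.basisVector]

/-! ### The bent graph of a general-spin shield on the unbent zone `{r < 4M}` -/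

/-- The representative of the bent slice map, general spin. -/
def bentRepA (M a : ℝ) : E3 → E4 := fun z ↦
  E4.ofTimeSpace (bentHeight M a (Kerr.radius a (E4.ofTimeSpace 0 z))) z

theorem bentRepA_eventuallyEq {M a : ℝ} (hM : 0 < M) {z : E3}
    (hz : Kerr.radius a (E4.ofTimeSpace 0 z) < 4 * M) :
    bentRepA M a =ᶠ[𝓝 z] E4.ofTimeSpace 0 := by
  have ho : IsOpen {z : E3 | Kerr.radius a (E4.ofTimeSpace 0 z) < 4 * M} :=
    isOpen_lt ((Kerr.continuous_radius a).comp (E4.continuous_ofTimeSpace 0)) continuous_const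
  filter_upwards [ho.mem_nhds hz] with u hu
  simp only [bentRepA]
  rw [bentHeight_eq_zero hM (le_of_lt hu)]

theorem bentRepA_apply {M a : ℝ} (hM : 0 < M) {z : E3}
    (hz : Kerr.radius a (E4.ofTimeSpace 0 z) < 4 * M) : bentRepA M a z = E4.ofTimeSpace 0 z :=
  (bentRepA_eventuallyEq hM hz).self_of_nhds

theorem differentiableAt_bentRepA {M a : ℝ} (hM : 0 < M) {z : E3}
    (hz : Kerr.radius a (E4.ofTimeSpace 0 z) < 4 * M) : DifferentiableAt ℝ (bentRepA M a) z :=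
  (Kerr.hasFDerivAt_ofTimeSpace_zero z).differentiableAt.congr_of_eventuallyEq
    (bentRepA_eventuallyEq hM hz)

theorem fderiv_bentRepA {M a : ℝ} (hM : 0 < M) {z : E3}
    (hz : Kerr.radius a (E4.ofTimeSpace 0 z) < 4 * M) (v : E3) :
    fderiv ℝ (bentRepA M a) z v = E4.ofTimeSpace 0 v := by
  rw [(bentRepA_eventuallyEq hM hz).fderiv_eq, Kerr.fderiv_ofTimeSpace_zero]

theorem radius_pos_of_mem_slice {a r₁ : ℝ} (y : Kerr.slice a r₁) :
    0 < Kerr.radius a (E4.ofTimeSpace 0 (y : E3)) :=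
  lt_of_le_of_lt (le_max_right _ _) (Kerr.mem_slice.1 y.2)

/-- On the unbent zone `{r < 4M}` the graph `ψ` of the crux IS the Kerr–Schild slice embedding. -/
theorem psiA_eq_sliceEmbed {M a r₁ : ℝ} (hMpos : 0 < M)
    {ψ : Kerr.slice a r₁ → Kerr.region a r₁}
    (hψ : ∀ y : Kerr.slice a r₁, (ψ y : E4) =
      E4.ofTimeSpace (bentHeight M a (Kerr.radius a (E4.ofTimeSpace 0 (y : E3)))) (y : E3))
    {y : Kerr.slice a r₁} (hy4 : Kerr.radius a (E4.ofTimeSpace 0 (y : E3)) < 4 * M) :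
    ψ y = Kerr.sliceEmbed a r₁ y := by
  apply Subtype.ext
  rw [hψ y, Kerr.coe_sliceEmbed]
  exact bentRepA_apply hMpos hy4

/-- … and its differential is `v ↦ (0, v)`. -/
theorem mfderiv_psiA {M a r₁ : ℝ} (hMpos : 0 < M)
    {ψ : Kerr.slice a r₁ → Kerr.region a r₁}
    (hψ : ∀ y : Kerr.slice a r₁, (ψ y : E4) =
      E4.ofTimeSpace (bentHeight M a (Kerr.radius a (E4.ofTimeSpace 0 (y : E3)))) (y : E3))
    {y : Kerr.slice a r₁} (hy4 : Kerr.radius a (E4.ofTimeSpace 0 (y : E3)) < 4 * M) (v : E3) :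
    mfderiv 𝓘(ℝ, E3) 𝓘(ℝ, E4) ψ y v = E4.ofTimeSpace 0 v := by
  rw [OpensChart.mfderiv_apply_of_repr (Φ := bentRepA M a) hψ (differentiableAt_bentRepA hMpos hy4),
    fderiv_bentRepA hMpos hy4]

/-- On the unbent zone the future unit normal of a general-spin shield IS `normalRepA`. -/
theorem nuA_eq_normalRepA [Kerr.Facts] {M a r₁ : ℝ} (hM : 0 ≤ M) (hMpos : 0 < M)
    {ψ : Kerr.slice a r₁ → Kerr.region a r₁} {ν : NormalField 𝓘(ℝ, E4) ψ}
    (hψ : ∀ y : Kerr.slice a r₁, (ψ y : E4) =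
      E4.ofTimeSpace (bentHeight M a (Kerr.radius a (E4.ofTimeSpace 0 (y : E3)))) (y : E3))
    (hν : (Kerr.smoothMetric M a r₁).IsFutureUnitNormal 𝓘(ℝ, E3)
      ((Kerr.timeOrientation M a r₁ hM).ofLE le_top) ψ ν)
    {y : Kerr.slice a r₁} (hy4 : Kerr.radius a (E4.ofTimeSpace 0 (y : E3)) < 4 * M) :
    ν y = normalRepA M a y := by
  have hx := radius_pos_of_mem_slice y
  have hψy : (ψ y : E4) = E4.ofTimeSpace 0 y := by
    rw [psiA_eq_sliceEmbed hMpos hψ hy4, Kerr.coe_sliceEmbed]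
  have h1 : ∀ w : E3, Kerr.bilin M a (E4.ofTimeSpace 0 y) (ν y) (E4.ofTimeSpace 0 w) = 0 := by
    intro w
    have := hν.1.1 y w
    rw [mfderiv_psiA hMpos hψ hy4] at this
    rw [← hψy]
    exact this
  have h2 : Kerr.bilin M a (E4.ofTimeSpace 0 y) (ν y) (ν y) = -1 := by
    rw [← hψy]; exact hν.1.2 y
  have h3 : Kerr.bilin M a (E4.ofTimeSpace 0 y)
      (Kerr.timeVector M a (E4.ofTimeSpace 0 y)) (ν y) < 0 := by
    rw [← hψy]; exact (hν.2 y).2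
  exact eq_normalRepA hM hx h1 h2 h3

/-- Second fundamental form of a map `f : slice a r₁ → region a r₁` with field `ν`, at a point
where `(f, ν)` has representatives tangent to the unbent Kerr–Schild slice to first order:
the `½ (∂g)` form, general spin (the normal-derivative term eliminated by
`bilin_fderiv_normalRepA`). [folklore] -/
theorem sffA_eq_half_of_repr [Kerr.Facts] {M a r₁ : ℝ} (hM : 0 ≤ M)
    [(Kerr.smoothMetric M a r₁).HasLeviCivita]
    {f : Kerr.slice a r₁ → Kerr.region a r₁} {Φ : E3 → E4} (hf : ∀ y, (f y : E4) = Φ y)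
    {ν : NormalField 𝓘(ℝ, E4) f} {N : E3 → E4} (hν : ∀ y, ν y = N y)
    {y : Kerr.slice a r₁} (hΦd : DifferentiableAt ℝ Φ y) (hNd : DifferentiableAt ℝ N y)
    (hfy : f y = Kerr.sliceEmbed a r₁ y)
    (hΦ' : ∀ v : E3, fderiv ℝ Φ y v = E4.ofTimeSpace 0 v)
    (hNy : N y = normalRepA M a y)
    (hN' : fderiv ℝ N y = fderiv ℝ (normalRepA M a) y) (v w : E3) :
    (Kerr.smoothMetric M a r₁).secondFundamentalForm 𝓘(ℝ, E3) f ν y v w =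
      2⁻¹ * (fderiv ℝ (Kerr.bilin M a) (E4.ofTimeSpace 0 y) (normalRepA M a y)
            (E4.ofTimeSpace 0 w) (E4.ofTimeSpace 0 v)
          - fderiv ℝ (Kerr.bilin M a) (E4.ofTimeSpace 0 y) (E4.ofTimeSpace 0 v)
            (normalRepA M a y) (E4.ofTimeSpace 0 w)
          - fderiv ℝ (Kerr.bilin M a) (E4.ofTimeSpace 0 y) (E4.ofTimeSpace 0 w)
            (E4.ofTimeSpace 0 v) (normalRepA M a y)) := by
  have hx := radius_pos_of_mem_slice y
  rw [OpensChart.secondFundamentalForm_eq_of_repr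
    (g := (Kerr.smoothMetric M a r₁).toPseudoRiemannianMetric)
    (G := Kerr.bilin M a) (Kerr.smoothMetric_val M a r₁) hf hν hΦd hNd
    (Kerr.differentiableAt_bilin M a _) v w, hN', hNy, hΦ', hΦ', hfy]
  have hΓ := OpensChart.val_christoffel_const
    (g := (Kerr.smoothMetric M a r₁).toPseudoRiemannianMetric)
    (G := Kerr.bilin M a) (Kerr.sliceEmbed a r₁ y) (normalRepA M a y)
    (E4.ofTimeSpace 0 v) (E4.ofTimeSpace 0 w)
  have hΓ' : Kerr.bilin M a (E4.ofTimeSpace 0 y) (OpensChart.christoffel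
      (Kerr.smoothMetric M a r₁).toPseudoRiemannianMetric (Kerr.bilin M a)
      (Kerr.sliceEmbed a r₁ y) (normalRepA M a y) (E4.ofTimeSpace 0 v))
      (E4.ofTimeSpace 0 w) =
      2⁻¹ * OpensChart.koszulForm (Kerr.bilin M a) (E4.ofTimeSpace 0 y)
        (normalRepA M a y) (E4.ofTimeSpace 0 v) (E4.ofTimeSpace 0 w) := hΓ
  show Kerr.bilin M a (E4.ofTimeSpace 0 y) (fderiv ℝ (normalRepA M a) y v +
      OpensChart.christoffel (Kerr.smoothMetric M a r₁).toPseudoRiemannianMetric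
      (Kerr.bilin M a) (Kerr.sliceEmbed a r₁ y) (normalRepA M a y)
      (E4.ofTimeSpace 0 v)) (E4.ofTimeSpace 0 w) = _
  rw [map_add, _root_.add_apply, hΓ', OpensChart.koszulForm_apply,
    bilin_fderiv_normalRepA hM hx v w]
  ring

/-- **The second fundamental form at the axis test point, closed form (any spin)**:
`K(e_z, e_z) = −2 H_ax′(u) (1 + H_ax(u)) / √(1 + 2 H_ax(u))` at `(0; 0, 0, u)`. [folklore] -/
theorem sffA_axisPt [Kerr.Facts] {M a r₁ : ℝ} (hM : 0 ≤ M)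
    [(Kerr.smoothMetric M a r₁).HasLeviCivita]
    {f : Kerr.slice a r₁ → Kerr.region a r₁} {Φ : E3 → E4} (hf : ∀ y, (f y : E4) = Φ y)
    {ν : NormalField 𝓘(ℝ, E4) f} {N : E3 → E4} (hν : ∀ y, ν y = N y)
    {u : ℝ} (hu : 0 < u) {y : Kerr.slice a r₁} (hyu : (y : E3) = axisPt u)
    (hΦd : DifferentiableAt ℝ Φ y) (hNd : DifferentiableAt ℝ N y)
    (hfy : f y = Kerr.sliceEmbed a r₁ y)
    (hΦ' : ∀ v : E3, fderiv ℝ Φ y v = E4.ofTimeSpace 0 v)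
    (hNy : N y = normalRepA M a y)
    (hN' : fderiv ℝ N y = fderiv ℝ (normalRepA M a) y) :
    (Kerr.smoothMetric M a r₁).secondFundamentalForm 𝓘(ℝ, E3) f ν y ez ez =
      -2 * (√(1 + 2 * Hax M a u))⁻¹ * dHax M a u * (1 + Hax M a u) := by
  rw [sffA_eq_half_of_repr hM hf hν hΦd hNd hfy hΦ' hNy hN' ez ez, hyu, ofTimeSpace_ez,
    normalRepA_axisPt M a hu]
  simp only [map_smul, map_sub, FunLike.coe_smul, FunLike.coe_sub,
    Pi.smul_apply, Pi.sub_apply, smul_eq_mul, fderiv_bilin_axis_Z M a hu,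
    fderiv_bilin_axis_zero M a hu, E4.tmul_apply, ell0_basisVector_zero, ell0_basisVector_three,
    zero_apply]
  ring


/-- The sign of the axis tooth: `H_ax′(3M) < 0` for sub-extremal parameters. -/
theorem dHax_three_mul_neg {M a : ℝ} (haM : |a| < M) : dHax M a (3 * M) < 0 := by
  have hM : 0 < M := (abs_nonneg a).trans_lt haM
  have ha : a ^ 2 < M ^ 2 := sq_lt_sq' (abs_lt.1 haM).1 (abs_lt.1 haM).2
  unfold dHax
  have h1 : M * (a ^ 2 - (3 * M) ^ 2) < 0 := by nlinarith
  have h2 : 0 < ((3 * M) ^ 2 + a ^ 2) ^ 2 := by positivity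
  exact div_neg_of_neg_of_pos h1 h2

theorem Hax_nonneg {M a u : ℝ} (hM : 0 ≤ M) (hu : 0 ≤ u) : 0 ≤ Hax M a u := by
  unfold Hax; positivity

/-- The axis tooth is POSITIVE: `−2 H_ax′(3M)(1 + H)/√(1 + 2H) > 0`. -/
theorem axisTooth_pos {M a : ℝ} (haM : |a| < M) :
    0 < -2 * (√(1 + 2 * Hax M a (3 * M)))⁻¹ * dHax M a (3 * M) * (1 + Hax M a (3 * M)) := by
  have hM : 0 < M := (abs_nonneg a).trans_lt haM
  have hH : 0 ≤ Hax M a (3 * M) := Hax_nonneg hM.le (by positivity)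
  have hd : 0 < -dHax M a (3 * M) := neg_pos.2 (dHax_three_mul_neg haM)
  have hs : 0 < (√(1 + 2 * Hax M a (3 * M)))⁻¹ := inv_pos.2 (Real.sqrt_pos.2 (by positivity))
  have : -2 * (√(1 + 2 * Hax M a (3 * M)))⁻¹ * dHax M a (3 * M) * (1 + Hax M a (3 * M)) =
      2 * (√(1 + 2 * Hax M a (3 * M)))⁻¹ * (-dHax M a (3 * M)) * (1 + Hax M a (3 * M)) := by ring
  rw [this]
  positivity

/-- The axis test point `(0, 0, 3M)` lies in the slice `{r > r₁}` of every shield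
(`r₁ < r₊ ≤ 2M < 3M = r(a, (0;0,0,3M))`). -/
theorem axisPt_mem_slice {M a r₁ : ℝ} (hM : 0 ≤ M) (haM : |a| < M) (hr₁ : r₁ < Kerr.rPlus M a) :
    axisPt (3 * M) ∈ Kerr.slice a r₁ := by
  have hMpos : 0 < M := (abs_nonneg a).trans_lt haM
  rw [Kerr.mem_slice, radius_axisPt a 0 (by positivity : (0:ℝ) < 3 * M)]
  have hs : √(M ^ 2 - a ^ 2) ≤ M := by
    rw [Real.sqrt_le_left hM]
    nlinarith [sq_nonneg a]
  have : Kerr.rPlus M a ≤ 2 * M := by unfold Kerr.rPlus; linarith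
  exact max_lt (by linarith) (by positivity)

open scoped Classical in
/-- **`k` of a Kerr-shielded datum at the axis test point (any spin)**: for a shield
`(φ, ψ, ν)` of `D` with parameters `(M, a, r₁)` and the axis point `y₀ = (0, 0, 3M)` of the
unbent zone, `k_{φ y₀}(dφ e_z, dφ e_z) = −2 H_ax′(3M)(1 + H_ax(3M))/√(1 + 2H_ax(3M))`. -/
theorem k_pullback_axisPt [Kerr.Facts] {X : Type*} [TopologicalSpace X] [ChartedSpace E3 X]
    [IsManifold (𝓡 3) ∞ X] (D : InitialDataSet (𝓡 3) X) {M a r₁ : ℝ} (hM : 0 ≤ M)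
    (haM : |a| < M) (hr₁ : r₁ < Kerr.rPlus M a)
    {φ : Kerr.slice a r₁ → X} {ψ : Kerr.slice a r₁ → Kerr.region a r₁}
    {ν : NormalField 𝓘(ℝ, E4) ψ}
    (hψ : ∀ y : Kerr.slice a r₁, (ψ y : E4) =
      E4.ofTimeSpace (bentHeight M a (Kerr.radius a (E4.ofTimeSpace 0 (y : E3)))) (y : E3))
    (hν : (Kerr.smoothMetric M a r₁).IsFutureUnitNormal 𝓘(ℝ, E3)
      ((Kerr.timeOrientation M a r₁ hM).ofLE le_top) ψ ν)
    (hk : ∀ [(Kerr.smoothMetric M a r₁).HasLeviCivita] (y : Kerr.slice a r₁),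
      (pullbackBilin (I := 𝓡 3) (I' := 𝓘(ℝ, E3)) φ D.k y).toLinearMap₁₂ =
        (Kerr.smoothMetric M a r₁).secondFundamentalForm 𝓘(ℝ, E3) ψ ν y) :
    D.k (φ ⟨axisPt (3 * M), axisPt_mem_slice hM haM hr₁⟩)
        (mfderiv 𝓘(ℝ, E3) (𝓡 3) φ ⟨axisPt (3 * M), axisPt_mem_slice hM haM hr₁⟩ ez)
        (mfderiv 𝓘(ℝ, E3) (𝓡 3) φ ⟨axisPt (3 * M), axisPt_mem_slice hM haM hr₁⟩ ez) =
      -2 * (√(1 + 2 * Hax M a (3 * M)))⁻¹ * dHax M a (3 * M) * (1 + Hax M a (3 * M)) := by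
  have hMpos : 0 < M := (abs_nonneg a).trans_lt haM
  have h3M : (0 : ℝ) < 3 * M := by positivity
  set y : Kerr.slice a r₁ := ⟨axisPt (3 * M), axisPt_mem_slice hM haM hr₁⟩ with hydef
  have hyE : (y : E3) = axisPt (3 * M) := rfl
  have hy4 : Kerr.radius a (E4.ofTimeSpace 0 (y : E3)) < 4 * M := by
    rw [hyE, radius_axisPt a 0 h3M]; linarith
  haveI : (Kerr.smoothMetric M a r₁).HasLeviCivita := PseudoRiemannianMetric.hasLeviCivita _
  -- global representatives of `ψ` and `ν`
  have hψ' : ∀ y : Kerr.slice a r₁, (ψ y : E4) = bentRepA M a y := hψ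
  set N : E3 → E4 := fun z ↦ if hz : z ∈ Kerr.slice a r₁ then (ν ⟨z, hz⟩ : E4) else 0
    with hNdef
  have hνN : ∀ y : Kerr.slice a r₁, ν y = N y := fun y ↦ by
    simp only [hNdef, dif_pos y.2]
  have hNloc : N =ᶠ[𝓝 (y : E3)] normalRepA M a := by
    have ho : IsOpen {z : E3 | z ∈ Kerr.slice a r₁ ∧ Kerr.radius a (E4.ofTimeSpace 0 z) < 4 * M} :=
      (Kerr.slice a r₁).2.inter (isOpen_lt ((Kerr.continuous_radius a).comp
        (E4.continuous_ofTimeSpace 0)) continuous_const)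
    filter_upwards [ho.mem_nhds ⟨y.2, hy4⟩] with z hz
    simp only [hNdef, dif_pos hz.1]
    exact nuA_eq_normalRepA hM hMpos hψ hν (y := ⟨z, hz.1⟩) hz.2
  have hx := radius_pos_of_mem_slice y
  have hNd : DifferentiableAt ℝ N y :=
    (differentiableAt_normalRepA hM hx).congr_of_eventuallyEq hNloc
  have hN' : fderiv ℝ N y = fderiv ℝ (normalRepA M a) y := hNloc.fderiv_eq
  have hNy : N y = normalRepA M a y := hNloc.self_of_nhds
  have e := LinearMap.congr_fun₂ (hk y) ez ez
  calc D.k (φ y) (mfderiv 𝓘(ℝ, E3) (𝓡 3) φ y ez) (mfderiv 𝓘(ℝ, E3) (𝓡 3) φ y ez)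
      = (pullbackBilin (I := 𝓡 3) (I' := 𝓘(ℝ, E3)) φ D.k y).toLinearMap₁₂ ez ez := rfl
    _ = (Kerr.smoothMetric M a r₁).secondFundamentalForm 𝓘(ℝ, E3) ψ ν y ez ez := e
    _ = _ := sffA_axisPt hM hψ' hνN h3M hyE (differentiableAt_bentRepA hMpos hy4) hNd
          (psiA_eq_sliceEmbed hMpos hψ hy4) (fderiv_bentRepA hMpos hy4) hNy hN'

/-! ### TEETH of the typed predicate, ANY SPIN -/

/-- **Every Kerr shield (any sub-extremal spin) forces `k ≢ 0`.** -/
theorem exists_k_ne_zero_of_isKerrShieldedWith [Kerr.Facts] {X : Type} [TopologicalSpace X]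
    [ChartedSpace E3 X] [IsManifold (𝓡 3) ∞ X] {D : InitialDataSet (𝓡 3) X} {M a r₁ : ℝ}
    (h : IsKerrShieldedWith M a r₁ X D) : ∃ x, D.k x ≠ 0 := by
  obtain ⟨hM, T, φ, ψ, ν, haM, -, hr₁', hT, -, -, -, hψ, -, hν, -, hk⟩ := h
  subst hT
  have key := k_pullback_axisPt D hM haM hr₁' hψ hν hk
  have hpos := axisTooth_pos haM
  refine ⟨φ ⟨axisPt (3 * M), axisPt_mem_slice hM haM hr₁'⟩, fun h0 ↦ ?_⟩
  rw [h0] at key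
  have : (0 : ℝ) = -2 * (√(1 + 2 * Hax M a (3 * M)))⁻¹ * dHax M a (3 * M) *
      (1 + Hax M a (3 * M)) := by
    rw [← key]; rfl
  linarith

/-- **No time-symmetric datum is Kerr-shielded, for any spin** (`k = 0` vs the axis tooth). -/
theorem not_isKerrShieldedWith_of_isTimeSymmetric [Kerr.Facts] {X : Type}
    [TopologicalSpace X] [ChartedSpace E3 X] [IsManifold (𝓡 3) ∞ X]
    {D : InitialDataSet (𝓡 3) X} (hD : D.IsTimeSymmetric) (M a r₁ : ℝ) :
    ¬ IsKerrShieldedWith M a r₁ X D := fun h ↦ by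
  obtain ⟨x, hx⟩ := exists_k_ne_zero_of_isKerrShieldedWith h
  exact hx (hD x)

/-- In particular flat data `(ℝ³, δ, 0)` carry NO shield of any spin. -/
theorem not_isKerrShieldedWith_trivialData [Kerr.Facts] (M a r₁ : ℝ) :
    ¬ IsKerrShieldedWith M a r₁ Minkowski.slice trivialData :=
  not_isKerrShieldedWith_of_isTimeSymmetric trivialData_isTimeSymmetric M a r₁


/-- **No time-symmetric datum is Kerr-shielded** (the `∃ (M, a, r₁)` form of the predicate). -/
theorem not_isKerrShielded_of_isTimeSymmetric [Kerr.Facts] {X : Type}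
    [TopologicalSpace X] [ChartedSpace E3 X] [IsManifold (𝓡 3) ∞ X]
    {D : InitialDataSet (𝓡 3) X} (hD : D.IsTimeSymmetric) : ¬ IsKerrShielded X D := fun h ↦ by
  obtain ⟨M, a, r₁, h'⟩ := isKerrShielded_iff.1 h
  exact not_isKerrShieldedWith_of_isTimeSymmetric hD M a r₁ h'

/-- Flat data `(ℝ³, δ, 0)` are not Kerr-shielded (any spin). -/
theorem not_isKerrShielded_trivialData [Kerr.Facts] : ¬ IsKerrShielded Minkowski.slice trivialData :=
  not_isKerrShielded_of_isTimeSymmetric trivialData_isTimeSymmetric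

/-- The crux with the guard `c ≠ 0` DROPPED: every member of the family, including `F 0 = d`,
is Kerr-shielded. -/
def ParametricKerrBurialWithoutNeZero : Prop :=
  ∀ [Kerr.Facts] (X : Type) [TopologicalSpace X] [ChartedSpace E3 X]
    [IsManifold (𝓡 3) ∞ X] [T2Space X] [SecondCountableTopology X] [ConnectedSpace X],
    ∀ d ∈ admissibleVacuumData X, ∃ F : EuclideanSpace ℝ (Fin 1) → InitialDataSet (𝓡 3) X,
      InitialDataSet.IsSmoothDataFamily 1 F ∧ F 0 = d ∧ Function.Injective F ∧
      (∀ c, F c ∈ admissibleVacuumData X) ∧ ∀ c, IsKerrShielded X (F c)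

/-- **Any proof must use the guard `c ≠ 0`**: the crux with `∀ c ≠ 0` replaced by `∀ c` is
FALSE (witness `X = Minkowski.slice`, `d = trivialData`: the member `F 0 = d` is time-symmetric,
hence unshieldable by the axis tooth, for every spin). [folklore] -/
theorem parametricKerrBurial_false_without_ne_zero : ¬ ParametricKerrBurialWithoutNeZero := by
  intro h
  obtain ⟨F, -, h0, -, -, hS⟩ := h Minkowski.slice trivialData trivialData_mem_admissibleVacuumData
  have h1 := hS 0
  rw [h0] at h1
  exact not_isKerrShielded_trivialData h1

/-- The degenerate strengthening "every admissible datum is ITSELF Kerr-shielded" (under which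
constant families would witness the crux) is false — for every spin (cf. §5, zero spin). -/
theorem not_forall_admissible_isKerrShielded :
    ¬ ∀ [Kerr.Facts] (X : Type) [TopologicalSpace X] [ChartedSpace E3 X]
        [IsManifold (𝓡 3) ∞ X] [T2Space X] [SecondCountableTopology X] [ConnectedSpace X],
        ∀ D ∈ admissibleVacuumData X, IsKerrShielded X D := by
  intro h
  exact not_isKerrShielded_trivialData
    (h Minkowski.slice trivialData trivialData_mem_admissibleVacuumData)

/-! ### `h` at the axis test point and the uniform size of the tooth -/

/-- **`h` of a Kerr-shielded datum at the axis test point (any spin)**: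
`h_{φ y₀}(dφ e_z, dφ e_z) = g(∂_z, ∂_z) = 1 + 2H_ax(3M)`. -/
theorem h_pullback_axisPt [Kerr.Facts] {X : Type*} [TopologicalSpace X] [ChartedSpace E3 X]
    [IsManifold (𝓡 3) ∞ X] (D : InitialDataSet (𝓡 3) X) {M a r₁ : ℝ} (hM : 0 ≤ M)
    (haM : |a| < M) (hr₁ : r₁ < Kerr.rPlus M a)
    {φ : Kerr.slice a r₁ → X} {ψ : Kerr.slice a r₁ → Kerr.region a r₁}
    (hψ : ∀ y : Kerr.slice a r₁, (ψ y : E4) =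
      E4.ofTimeSpace (bentHeight M a (Kerr.radius a (E4.ofTimeSpace 0 (y : E3)))) (y : E3))
    (hh : ∀ y : Kerr.slice a r₁,
      pullbackBilin (I := 𝓡 3) (I' := 𝓘(ℝ, E3)) φ D.h.inner y =
        pullbackBilin (I := 𝓘(ℝ, E4)) (I' := 𝓘(ℝ, E3)) ψ (Kerr.smoothMetric M a r₁).val y) :
    D.h.inner (φ ⟨axisPt (3 * M), axisPt_mem_slice hM haM hr₁⟩)
        (mfderiv 𝓘(ℝ, E3) (𝓡 3) φ ⟨axisPt (3 * M), axisPt_mem_slice hM haM hr₁⟩ ez)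
        (mfderiv 𝓘(ℝ, E3) (𝓡 3) φ ⟨axisPt (3 * M), axisPt_mem_slice hM haM hr₁⟩ ez) =
      1 + 2 * Hax M a (3 * M) := by
  have hMpos : 0 < M := (abs_nonneg a).trans_lt haM
  have h3M : (0 : ℝ) < 3 * M := by positivity
  set y : Kerr.slice a r₁ := ⟨axisPt (3 * M), axisPt_mem_slice hM haM hr₁⟩ with hydef
  have hyE : (y : E3) = axisPt (3 * M) := rfl
  have hy4 : Kerr.radius a (E4.ofTimeSpace 0 (y : E3)) < 4 * M := by
    rw [hyE, radius_axisPt a 0 h3M]; linarith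
  have e : D.h.inner (φ y) (mfderiv 𝓘(ℝ, E3) (𝓡 3) φ y ez) (mfderiv 𝓘(ℝ, E3) (𝓡 3) φ y ez) =
      (Kerr.smoothMetric M a r₁).val (ψ y) (mfderiv 𝓘(ℝ, E3) 𝓘(ℝ, E4) ψ y ez)
        (mfderiv 𝓘(ℝ, E3) 𝓘(ℝ, E4) ψ y ez) :=
    DFunLike.congr_fun (DFunLike.congr_fun (hh y) ez) ez
  rw [e, mfderiv_psiA hMpos hψ hy4, Kerr.smoothMetric_val, psiA_eq_sliceEmbed hMpos hψ hy4,
    Kerr.coe_sliceEmbed]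
  show Kerr.bilin M a (E4.ofTimeSpace 0 (y : E3)) (E4.ofTimeSpace 0 ez) (E4.ofTimeSpace 0 ez) =
    1 + 2 * Hax M a (3 * M)
  rw [hyE, ofTimeSpace_ez, bilin_axisPt M a 0 h3M]
  have hη : Minkowski.bilin (E4.basisVector 3) (E4.basisVector 3) = 1 := by
    rw [Kerr.minkowski_bilin_basisVector]
    simp [Kerr.etaComp, show ((3 : Fin 4) = 0) = False by decide]
  simp only [_root_.add_apply, FunLike.coe_smul, Pi.smul_apply, smul_eq_mul, E4.tmul_apply,
    ell0_basisVector_three, hη]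
  ring

/-- `H_ax(3M) ≤ 1/3`, so `h(dφ e_z, dφ e_z) = 1 + 2H ≤ 5/3` at the tooth. -/
theorem Hax_three_mul_le {M a : ℝ} (hM : 0 < M) : Hax M a (3 * M) ≤ 1 / 3 := by
  unfold Hax
  rw [div_le_div_iff₀ (by positivity) (by norm_num)]
  nlinarith [sq_nonneg a]

/-- Uniform size of the axis tooth: `−H_ax′(3M) ≥ 2/(25M)` for `|a| < M`
(`63M⁴ − 61M²a² − 2a⁴ = (M² − a²)(63M² + 2a²) ≥ 0`). -/
theorem neg_dHax_three_mul_ge {M a : ℝ} (haM : |a| < M) : 2 / (25 * M) ≤ -dHax M a (3 * M) := by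
  have hM : 0 < M := (abs_nonneg a).trans_lt haM
  have ha : a ^ 2 < M ^ 2 := sq_lt_sq' (abs_lt.1 haM).1 (abs_lt.1 haM).2
  unfold dHax
  rw [← neg_div, neg_mul_eq_mul_neg, neg_sub, div_le_div_iff₀ (by positivity) (by positivity)]
  have key : 0 ≤ (M ^ 2 - a ^ 2) * (63 * M ^ 2 + 2 * a ^ 2) :=
    mul_nonneg (by linarith) (by positivity)
  nlinarith [key]

/-- **The tooth is uniformly large for bounded mass**: `tooth ≥ 4/(25M)`. -/
theorem axisTooth_ge {M a : ℝ} (haM : |a| < M) :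
    4 / (25 * M) ≤ -2 * (√(1 + 2 * Hax M a (3 * M)))⁻¹ * dHax M a (3 * M) * (1 + Hax M a (3 * M)) := by
  have hM : 0 < M := (abs_nonneg a).trans_lt haM
  set H := Hax M a (3 * M) with hH
  have hH0 : 0 ≤ H := Hax_nonneg hM.le (by positivity)
  set s := √(1 + 2 * H) with hs
  have hs0 : 0 < s := Real.sqrt_pos.2 (by positivity)
  have hsle : s ≤ 1 + H := by
    rw [hs, show (1 : ℝ) + H = √((1 + H) ^ 2) by rw [Real.sqrt_sq (by positivity)]]
    exact Real.sqrt_le_sqrt (by nlinarith)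
  have h1 : 1 ≤ s⁻¹ * (1 + H) := by
    calc (1 : ℝ) = s⁻¹ * s := (inv_mul_cancel₀ hs0.ne').symm
      _ ≤ s⁻¹ * (1 + H) := mul_le_mul_of_nonneg_left hsle (inv_pos.2 hs0).le
  have h2 := neg_dHax_three_mul_ge haM
  have h3 : 0 ≤ 2 / (25 * M) := by positivity
  calc 4 / (25 * M) = 2 * 1 * (2 / (25 * M)) := by ring
    _ ≤ 2 * (s⁻¹ * (1 + H)) * (-dHax M a (3 * M)) :=
        mul_le_mul (mul_le_mul_of_nonneg_left h1 (by norm_num)) h2 h3 (by positivity)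
    _ = -2 * s⁻¹ * dHax M a (3 * M) * (1 + H) := by ring

/-! ## §9  ALL-SPIN swell-or-recede (cycle 3): the `c → 0` limit for the FULL predicate

§7 (zero spin) used the INTRINSIC tooth `R > 0`; for general spin we use the EXTRINSIC axis tooth
of §8 together with the `h`-clause at the same point: at `x = φ(0,0,3M)`, `v = dφ e_z`,
`h(v, v) = g(∂_z, ∂_z) = 1 + 2H ≤ 5/3` (`h_pullback_axisPt`, `Hax_three_mul_le`) and
`k(v, v) ≥ 4/(25M)` UNIFORMLY in the spin (`axisTooth_ge`, from
`63M⁴ − 61M²a² − 2a⁴ = (M² − a²)(63M² + 2a²) ≥ 0`). Along a smooth family BOTH sections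
`(c, x) ↦ h, k` are jointly continuous (`contDiffAt_repr_of_isSmoothDataFamily` of §7 and its
`k`-twin `contDiffAt_kRepr_of_isSmoothDataFamily`), so normalising `v` and extracting two
subsequences (`C` compact, unit sphere compact) gives in the limit `ρ·h₀(u*, u*) ≤ k₀(u*, u*) = 0`
with `h₀(u*, u*) > 0` whenever the centre `F 0` is TIME-SYMMETRIC: `not_confined_burial_of_mass_le`.
So for every spin the horizons of a burial family through a time-symmetric datum (flat data,
Brill waves, …) must SWELL (`Mₙ → ∞`) or RECEDE to infinity — the typed genericity is escaped
only where it has no topology (route kill criterion (e), now quantified for the full predicate). -/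

section Limit

/-- **Bridge from bundle smoothness to calculus, `k`-part**: along a smooth family of data on a
chart domain `U ⊆ E3`, any representative `K c` of `k_c` is jointly `C^∞` in `(c, y)`. -/
theorem contDiffAt_kRepr_of_isSmoothDataFamily {U : TopologicalSpace.Opens E3}
    {F : P1 → InitialDataSet 𝓘(ℝ, E3) U} (hF : InitialDataSet.IsSmoothDataFamily 1 F)
    {K : P1 → E3 → E3 →L[ℝ] E3 →L[ℝ] ℝ} (hK : ∀ c (y : U), (F c).k y = K c y)
    (c₀ : P1) (y₀ : U) :
    ContDiffAt ℝ ∞ (Function.uncurry K) (c₀, (y₀ : E3)) := by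
  classical
  have h1 := hF.2 (c₀, y₀)
  rw [contMDiffAt_bilin_iff] at h1
  obtain ⟨-, h2⟩ := h1
  have hsymm : ∀ (z : U) (v : E3),
      (trivializationAt E3 (TangentSpace 𝓘(ℝ, E3) : U → Type _) y₀).symmL ℝ z v = v := by
    intro z v
    rw [Bundle.Trivialization.symmL_apply _ (by simp [OpensChart.chartAt_source])]
    exact OpensChart.trivializationAt_symm_apply y₀ z v
  have hfun : (fun x : P1 × U ↦ (ContinuousLinearMap.precomp ℝ
      ((trivializationAt E3 (TangentSpace 𝓘(ℝ, E3) : U → Type _) y₀).symmL ℝ x.2)).comp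
        (((F x.1).k x.2).comp
          ((trivializationAt E3 (TangentSpace 𝓘(ℝ, E3) : U → Type _) y₀).symmL ℝ x.2))) =
      fun x ↦ K x.1 x.2 := by
    funext x
    ext v w
    simp only [ContinuousLinearMap.comp_apply, ContinuousLinearMap.precomp_apply, hsymm, hK]
    rfl
  rw [hfun] at h2
  set σ : E3 → U := fun z ↦ if hz : z ∈ U then ⟨z, hz⟩ else y₀ with hσdef
  have hσval : ∀ z ∈ (U : Set E3), (σ z : E3) = z := fun z hz ↦ by
    have hz' : z ∈ U := hz
    simp only [hσdef]
    rw [dif_pos hz']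
  have hσy₀ : σ y₀ = y₀ := by
    simp only [hσdef]
    rw [dif_pos y₀.2]
  have hUo : IsOpen ((Set.univ : Set P1) ×ˢ (U : Set E3)) := isOpen_univ.prod U.2
  have hmem : (c₀, (y₀ : E3)) ∈ (Set.univ : Set P1) ×ˢ (U : Set E3) := ⟨trivial, y₀.2⟩
  have hj2 : ContMDiffAt 𝓘(ℝ, P1 × E3) 𝓘(ℝ, E3) ∞ (fun q : P1 × E3 ↦ σ q.2) (c₀, (y₀ : E3)) := by
    rw [← ContMDiffAt.subtypeVal_comp_iff]
    have hev : (Subtype.val ∘ fun q : P1 × E3 ↦ σ q.2) =ᶠ[𝓝 (c₀, (y₀ : E3))] Prod.snd := by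
      filter_upwards [hUo.mem_nhds hmem] with q hq
      exact hσval q.2 hq.2
    exact contDiff_snd.contMDiff.contMDiffAt.congr_of_eventuallyEq hev
  have hj : ContMDiffAt 𝓘(ℝ, P1 × E3) (𝓘(ℝ, P1).prod 𝓘(ℝ, E3)) ∞
      (fun q : P1 × E3 ↦ (q.1, σ q.2)) (c₀, (y₀ : E3)) :=
    contDiff_fst.contMDiff.contMDiffAt.prodMk hj2
  have hcomp : ContMDiffAt 𝓘(ℝ, P1 × E3) 𝓘(ℝ, E3 →L[ℝ] E3 →L[ℝ] ℝ) ∞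
      ((fun x : P1 × U ↦ K x.1 x.2) ∘ fun q : P1 × E3 ↦ (q.1, σ q.2)) (c₀, (y₀ : E3)) :=
    ContMDiffAt.comp_of_eq h2 hj (Prod.ext rfl hσy₀)
  have hev2 : Function.uncurry K =ᶠ[𝓝 (c₀, (y₀ : E3))]
      ((fun x : P1 × U ↦ K x.1 x.2) ∘ fun q : P1 × E3 ↦ (q.1, σ q.2)) := by
    filter_upwards [hUo.mem_nhds hmem] with q hq
    simp only [Function.comp_apply, Function.uncurry, hσval q.2 hq.2]
  exact contMDiffAt_iff_contDiffAt.1 (hcomp.congr_of_eventuallyEq hev2)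

/-- The evaluation `(B, u) ↦ B u u` is continuous. [folklore] -/
theorem continuous_eval₂ :
    Continuous fun p : (E3 →L[ℝ] E3 →L[ℝ] ℝ) × E3 ↦ p.1 p.2 p.2 :=
  (continuous_fst.clm_apply continuous_snd).clm_apply continuous_snd

/-- The shielding predicate, ANY spin, parameters exposed, with the near-junction (unbent) zone
`{r < 4M}` CONFINED to the set `C`. -/
def IsKerrShieldedWithin [Kerr.Facts] (M a r₁ : ℝ) (X : Type) [TopologicalSpace X]
    [ChartedSpace E3 X] [IsManifold (𝓡 3) ∞ X] (D : InitialDataSet (𝓡 3) X) (C : Set X) : Prop :=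
  ∃ (hM : 0 ≤ M) (T : ℝ → ℝ) (φ : Kerr.slice a r₁ → X)
    (ψ : Kerr.slice a r₁ → Kerr.region a r₁) (ν : NormalField 𝓘(ℝ, E4) ψ),
    |a| < M ∧ Kerr.rMinus M a < r₁ ∧ r₁ < Kerr.rPlus M a ∧ T = bentHeight M a ∧
    IsCompact (Set.range φ)ᶜ ∧ Topology.IsOpenEmbedding φ ∧
    ContMDiff 𝓘(ℝ, E3) (𝓡 3) ∞ φ ∧
    (∀ y : Kerr.slice a r₁, (ψ y : E4) =
      E4.ofTimeSpace (T (Kerr.radius a (E4.ofTimeSpace 0 (y : E3)))) (y : E3)) ∧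
    (Kerr.smoothMetric M a r₁).IsSpacelikeImmersion 𝓘(ℝ, E3) ψ ∧
    (Kerr.smoothMetric M a r₁).IsFutureUnitNormal 𝓘(ℝ, E3)
      ((Kerr.timeOrientation M a r₁ hM).ofLE le_top) ψ ν ∧
    (∀ y : Kerr.slice a r₁,
      pullbackBilin (I := 𝓡 3) (I' := 𝓘(ℝ, E3)) φ D.h.inner y =
        pullbackBilin (I := 𝓘(ℝ, E4)) (I' := 𝓘(ℝ, E3)) ψ (Kerr.smoothMetric M a r₁).val y) ∧
    (∀ [(Kerr.smoothMetric M a r₁).HasLeviCivita] (y : Kerr.slice a r₁),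
      (pullbackBilin (I := 𝓡 3) (I' := 𝓘(ℝ, E3)) φ D.k y).toLinearMap₁₂ =
        (Kerr.smoothMetric M a r₁).secondFundamentalForm 𝓘(ℝ, E3) ψ ν y) ∧
    (∀ y : Kerr.slice a r₁, Kerr.radius a (E4.ofTimeSpace 0 (y : E3)) < 4 * M → φ y ∈ C)

/-- A confined shield is a shield. -/
theorem IsKerrShieldedWithin.isKerrShieldedWith [Kerr.Facts] {M a r₁ : ℝ} {X : Type}
    [TopologicalSpace X] [ChartedSpace E3 X] [IsManifold (𝓡 3) ∞ X]
    {D : InitialDataSet (𝓡 3) X} {C : Set X} (h : IsKerrShieldedWithin M a r₁ X D C) :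
    IsKerrShieldedWith M a r₁ X D := by
  obtain ⟨hM, T, φ, ψ, ν, h1, h2, h3, h4, h5, h6, h7, h8, h9, h10, h11, h12, -⟩ := h
  exact ⟨hM, T, φ, ψ, ν, h1, h2, h3, h4, h5, h6, h7, h8, h9, h10, h11, h12⟩

/-- **The tooth of a confined shield**: a point `x ∈ C` and a tangent vector `v` with
`h(v, v) ≤ 5/3` and `k(v, v) ≥ 4/(25M)`. -/
theorem IsKerrShieldedWithin.exists_tooth [Kerr.Facts] {M a r₁ : ℝ} {X : Type}
    [TopologicalSpace X] [ChartedSpace E3 X] [IsManifold (𝓡 3) ∞ X]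
    {D : InitialDataSet (𝓡 3) X} {C : Set X} (h : IsKerrShieldedWithin M a r₁ X D C) :
    ∃ x ∈ C, ∃ v : TangentSpace (𝓡 3) x,
      D.h.inner x v v ≤ 5 / 3 ∧ 4 / (25 * M) ≤ D.k x v v := by
  obtain ⟨hM, T, φ, ψ, ν, haM, -, hr₁', hT, -, -, -, hψ, -, hν, hh, hk, hCφ⟩ := h
  have hMpos : 0 < M := (abs_nonneg a).trans_lt haM
  have h3M : (0 : ℝ) < 3 * M := by positivity
  subst hT
  set y₀ : Kerr.slice a r₁ := ⟨axisPt (3 * M), axisPt_mem_slice hM haM hr₁'⟩ with hy₀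
  have hy4 : Kerr.radius a (E4.ofTimeSpace 0 (y₀ : E3)) < 4 * M := by
    show Kerr.radius a (E4.ofTimeSpace 0 (axisPt (3 * M))) < 4 * M
    rw [radius_axisPt a 0 h3M]; linarith
  refine ⟨φ y₀, hCφ y₀ hy4, mfderiv 𝓘(ℝ, E3) (𝓡 3) φ y₀ ez, ?_, ?_⟩
  · rw [h_pullback_axisPt D hM haM hr₁' hψ hh]
    have := Hax_three_mul_le (a := a) hMpos
    linarith
  · rw [k_pullback_axisPt D hM haM hr₁' hψ hν hk]
    exact axisTooth_ge haM

set_option maxHeartbeats 400000 in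
/-- **ALL-SPIN swell-or-recede** (the confined bounded-mass strengthening of the crux refuted at
every TIME-SYMMETRIC centre): let `F` be a smooth one-parameter family of data on `ℝ³` whose
member `F 0` is time-symmetric (`k ≡ 0`: flat data, Brill waves, …), let `cₙ → 0`, and suppose
each `F cₙ` carries a Kerr shield (ANY spin) of mass `Mₙ ≤ μ` whose near-junction zone
`φₙ({r < 4Mₙ})` lies in a FIXED compact set `C`. Then `False`: the axis teeth
`k(vₙ, vₙ) ≥ 4/(25μ)` with `h(vₙ, vₙ) ≤ 5/3` at points of `C` contradict the joint continuity of
`(c, x) ↦ (h, k)` at `c = 0`, where `k ≡ 0`. So the horizons of a burial family through a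
time-symmetric datum must SWELL (`Mₙ → ∞`) or RECEDE to infinity. -/
theorem not_confined_burial_of_mass_le [Kerr.Facts]
    {F : P1 → InitialDataSet (𝓡 3) Minkowski.slice}
    (hF : InitialDataSet.IsSmoothDataFamily 1 F) (h0 : (F 0).IsTimeSymmetric)
    {c : ℕ → P1} (hc : Tendsto c atTop (𝓝 0)) {M a r₁ : ℕ → ℝ}
    {C : Set Minkowski.slice} (hC : IsCompact C) {μ : ℝ} (hμ : ∀ n, M n ≤ μ)
    (hS : ∀ n, IsKerrShieldedWithin (M n) (a n) (r₁ n) Minkowski.slice (F (c n)) C) : False := by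
  -- the teeth
  have hMpos : ∀ n, 0 < M n := fun n ↦ by
    obtain ⟨hM, T, φ, ψ, ν, haM, -⟩ := (hS n).isKerrShieldedWith
    exact (abs_nonneg (a n)).trans_lt haM
  have hμpos : 0 < μ := (hMpos 0).trans_le (hμ 0)
  have hn : ∀ n, ∃ x ∈ C, ∃ v : E3,
      (F (c n)).h.inner x v v ≤ 5 / 3 ∧ 4 / (25 * μ) ≤ (F (c n)).k x v v := by
    intro n
    obtain ⟨x, hxC, v, hv1, hv2⟩ := (hS n).exists_tooth
    refine ⟨x, hxC, v, hv1, le_trans ?_ hv2⟩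
    exact div_le_div_of_nonneg_left (by norm_num) (by have := hMpos n; positivity)
      (by nlinarith [hμ n])
  choose x hxC v hv1 hv2 using hn
  -- representatives, jointly continuous
  set G : P1 → E3 → E3 →L[ℝ] E3 →L[ℝ] ℝ := fun c z ↦ (F c).h.inner ⟨z, Minkowski.mem_slice z⟩
    with hGdef
  set K : P1 → E3 → E3 →L[ℝ] E3 →L[ℝ] ℝ := fun c z ↦ (F c).k ⟨z, Minkowski.mem_slice z⟩
    with hKdef
  have hGc : ∀ q : P1 × E3, ContinuousAt (Function.uncurry G) q := fun q ↦
    (contDiffAt_repr_of_isSmoothDataFamily hF (G := G) (fun c y ↦ rfl) q.1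
      ⟨q.2, Minkowski.mem_slice q.2⟩).continuousAt
  have hKc : ∀ q : P1 × E3, ContinuousAt (Function.uncurry K) q := fun q ↦
    (contDiffAt_kRepr_of_isSmoothDataFamily hF (K := K) (fun c y ↦ rfl) q.1
      ⟨q.2, Minkowski.mem_slice q.2⟩).continuousAt
  -- normalise the tooth vectors
  have hvne : ∀ n, v n ≠ 0 := fun n h ↦ by
    have h2 := hv2 n
    have hz1 : (F (c n)).k (x n) (v n) = 0 := by rw [h]; exact map_zero _
    have hz : (F (c n)).k (x n) (v n) (v n) = 0 := by rw [hz1]; rfl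
    have : (0:ℝ) < 4 / (25 * μ) := by positivity
    linarith
  set u : ℕ → E3 := fun n ↦ ‖v n‖⁻¹ • v n with hudef
  have hu1 : ∀ n, ‖u n‖ = 1 := fun n ↦ by
    rw [hudef]
    simp only [norm_smul, norm_inv, norm_norm]
    exact inv_mul_cancel₀ (norm_ne_zero_iff.2 (hvne n))
  have hscale : ∀ n (B : E3 →L[ℝ] E3 →L[ℝ] ℝ), B (u n) (u n) = (‖v n‖ ^ 2)⁻¹ * B (v n) (v n) := by
    intro n B
    simp only [hudef, map_smul, FunLike.coe_smul, Pi.smul_apply, smul_eq_mul]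
    ring
  -- ratio bound: k(u,u) ≥ ρ h(u,u), ρ = (4/(25μ))/(5/3)
  set ρ : ℝ := 4 / (25 * μ) / (5 / 3) with hρ
  have hρpos : 0 < ρ := by positivity
  have hratio : ∀ n, ρ * G (c n) (x n) (u n) (u n) ≤ K (c n) (x n) (u n) (u n) := by
    intro n
    have hG' : G (c n) (x n) = (F (c n)).h.inner (x n) := rfl
    have hK' : K (c n) (x n) = (F (c n)).k (x n) := rfl
    rw [hscale n, hscale n, hG', hK']
    have hp : 0 < (‖v n‖ ^ 2)⁻¹ := by
      have := norm_pos_iff.2 (hvne n); positivity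
    have h1 := hv1 n
    have h2 := hv2 n
    have hhpos : 0 ≤ (F (c n)).h.inner (x n) (v n) (v n) :=
      le_of_lt ((F (c n)).h.pos (x n) (v n) (hvne n))
    -- ρ h(v,v) ≤ ρ (5/3) = 4/(25μ) ≤ k(v,v)
    have h3 : ρ * (F (c n)).h.inner (x n) (v n) (v n) ≤ (F (c n)).k (x n) (v n) (v n) := by
      calc ρ * (F (c n)).h.inner (x n) (v n) (v n) ≤ ρ * (5 / 3) :=
            mul_le_mul_of_nonneg_left h1 hρpos.le
        _ = 4 / (25 * μ) := by rw [hρ]; field_simp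
        _ ≤ _ := h2
    calc ρ * ((‖v n‖ ^ 2)⁻¹ * (F (c n)).h.inner (x n) (v n) (v n))
        = (‖v n‖ ^ 2)⁻¹ * (ρ * (F (c n)).h.inner (x n) (v n) (v n)) := by ring
      _ ≤ (‖v n‖ ^ 2)⁻¹ * (F (c n)).k (x n) (v n) (v n) := mul_le_mul_of_nonneg_left h3 hp.le
  -- subsequences: xₙ → x*, then uₙ → u*
  obtain ⟨xs, hxs, κ, hκ, hlimx⟩ := hC.tendsto_subseq hxC
  have husph : ∀ n, u (κ n) ∈ Metric.sphere (0 : E3) 1 := fun n ↦ by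
    rw [Metric.mem_sphere, dist_zero_right]; exact hu1 _
  obtain ⟨us, hus, κ', hκ', hlimu⟩ := (isCompact_sphere (0 : E3) 1).tendsto_subseq husph
  have hus1 : ‖us‖ = 1 := by rwa [Metric.mem_sphere, dist_zero_right] at hus
  have husne : us ≠ 0 := fun h ↦ by rw [h, norm_zero] at hus1; exact zero_ne_one hus1
  -- the limits
  have hcκ : Tendsto (fun n ↦ c (κ (κ' n))) atTop (𝓝 0) :=
    hc.comp (hκ.tendsto_atTop.comp hκ'.tendsto_atTop)
  have hxκ : Tendsto (fun n ↦ ((x (κ (κ' n)) : E3))) atTop (𝓝 (xs : E3)) :=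
    ((continuous_subtype_val.tendsto xs).comp hlimx).comp hκ'.tendsto_atTop
  have hq : Tendsto (fun n ↦ (c (κ (κ' n)), (x (κ (κ' n)) : E3))) atTop (𝓝 (0, (xs : E3))) :=
    hcκ.prodMk_nhds hxκ
  have hGlim : Tendsto (fun n ↦ G (c (κ (κ' n))) (x (κ (κ' n)))) atTop (𝓝 (G 0 xs)) :=
    ((hGc (0, (xs : E3))).tendsto).comp hq
  have hKlim : Tendsto (fun n ↦ K (c (κ (κ' n))) (x (κ (κ' n)))) atTop (𝓝 (K 0 xs)) :=
    ((hKc (0, (xs : E3))).tendsto).comp hq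
  have hGev : Tendsto (fun n ↦ G (c (κ (κ' n))) (x (κ (κ' n))) (u (κ (κ' n))) (u (κ (κ' n))))
      atTop (𝓝 (G 0 xs us us)) :=
    (continuous_eval₂.tendsto (G 0 xs, us)).comp (hGlim.prodMk_nhds hlimu)
  have hKev : Tendsto (fun n ↦ K (c (κ (κ' n))) (x (κ (κ' n))) (u (κ (κ' n))) (u (κ (κ' n))))
      atTop (𝓝 (K 0 xs us us)) :=
    (continuous_eval₂.tendsto (K 0 xs, us)).comp (hKlim.prodMk_nhds hlimu)
  have hK0 : K 0 xs us us = 0 := by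
    have : K 0 xs = 0 := h0 ⟨xs, Minkowski.mem_slice xs⟩
    rw [this]; rfl
  have hG0 : 0 < G 0 xs us us := (F 0).h.pos ⟨xs, Minkowski.mem_slice xs⟩ us husne
  -- pass to the limit in `ρ G(u,u) ≤ K(u,u)`
  have hle : ρ * G 0 xs us us ≤ K 0 xs us us :=
    le_of_tendsto_of_tendsto (hGev.const_mul ρ) hKev (Eventually.of_forall fun n ↦ hratio _)
  rw [hK0] at hle
  nlinarith [hle, hG0, hρpos]

/-- **All-spin swell-or-recede at FLAT data** (the crux's test datum; cf. the zero-spin §7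
`not_confined_zeroSpin_burial`): along `cₙ → 0` the members of a smooth family through
`trivialData` cannot carry Kerr shields of any spin with masses `≤ μ` whose near-junction zones
stay in one compact set. -/
theorem not_confined_burial_trivialData [Kerr.Facts]
    {F : P1 → InitialDataSet (𝓡 3) Minkowski.slice}
    (hF : InitialDataSet.IsSmoothDataFamily 1 F) (h0 : F 0 = trivialData)
    {c : ℕ → P1} (hc : Tendsto c atTop (𝓝 0)) {M a r₁ : ℕ → ℝ}
    {C : Set Minkowski.slice} (hC : IsCompact C) {μ : ℝ} (hμ : ∀ n, M n ≤ μ)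
    (hS : ∀ n, IsKerrShieldedWithin (M n) (a n) (r₁ n) Minkowski.slice (F (c n)) C) : False :=
  not_confined_burial_of_mass_le hF (h0 ▸ trivialData_isTimeSymmetric) hc hC hμ hS

/-- **All-spin swell-or-recede, filter form**: through a time-symmetric centre, for every compact
set `C` and mass bound `μ`, ALL SUFFICIENTLY SMALL parameters `c` carry NO Kerr shield of mass
`≤ μ` (any spin) whose near-junction zone lies in `C` — the shields of a burial family leave every
compact set (or their masses blow up) as `c → 0`. -/
theorem eventually_not_confined [Kerr.Facts]
    {F : P1 → InitialDataSet (𝓡 3) Minkowski.slice}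
    (hF : InitialDataSet.IsSmoothDataFamily 1 F) (h0 : (F 0).IsTimeSymmetric)
    {C : Set Minkowski.slice} (hC : IsCompact C) (μ : ℝ) :
    ∀ᶠ c in 𝓝 (0 : P1), ∀ M a r₁ : ℝ, M ≤ μ →
      ¬ IsKerrShieldedWithin M a r₁ Minkowski.slice (F c) C := by
  by_contra h
  rw [Filter.not_eventually] at h
  obtain ⟨c, hc, hcP⟩ := Filter.exists_seq_forall_of_frequently h
  have hcP' : ∀ n, ∃ M a r₁ : ℝ, M ≤ μ ∧ IsKerrShieldedWithin M a r₁ Minkowski.slice (F (c n)) C :=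
    fun n ↦ by
      by_contra h'
      exact hcP n (fun M a r₁ hM hS ↦ h' ⟨M, a, r₁, hM, hS⟩)
  choose M a r₁ hμ hS using hcP'
  exact not_confined_burial_of_mass_le hF h0 hc hC hμ hS

end Limit


/-! ## Targets (cycle 3) — the picked line `receding-annulus-universal-collar` and its stubs

No stuck stubs were handed over (`payload.targets = []`); the three registered stubs of
`Lines/receding-annulus-universal-collar.lean` were read for CHEAP TYPED KILLS (a universally
quantified stub false at junk inputs would force a reshape). Findings — no kill:
* `stub_farGluing` (∃-statement per admissible `d`): analytic (Mao–Oh–Tao Thm 1.7/1.10 + smooth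
  dependence on the radius); it consumes admissibility exactly as §2 demands. Nothing typed to bite.
* `stub_collarDatum` (one admissible collar `C` on `E3`, Schwarzschild(`μ`) on `{1 < ‖y‖ < 2}`,
  `IsKerrShieldedAway 2`): by §8 EVERY shield of `C` has `k ≠ 0` at its axis point, and by §6 (zero
  spin) `R > 0` on its unbent zone — both compatible with the time-symmetric annulus because the
  shield ranges in `{‖y‖ > 2}`; the stub implies `KerrShieldedDataExist` (drefute's corollary) and,
  with §3, is NECESSARY in substance for the crux. It is the honest hard core; no obstruction known
  (Li–Mei is its `μ = 0` shadow).
* `stub_splice` (∀-statement): junk hunt — negative chart radii are excluded by `AFEnd.R_pos`;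
  `(e.far Rstar)ᶜ ≠ ∅` because the chart is onto `exteriorRegion e.R ⊋ {‖x‖ > Rstar}`; the datum
  `d` carries NO hypothesis, but the conclusion only needs `S (R, 0) = d` off `e.far R`, which the
  hypothesis `AgreeAt (G R) d` off `e.far R` makes satisfiable in substance (dilated collar patched
  to `G R` along the exact Schwarzschild(`m R`) annulus `{λ < ‖x‖ < 2λ} ⊆ {32R < ‖x‖}`,
  `λ = m R/μ ≥ 32R`). §4 `bentHeight_scale` is what makes the dilated shield typed-correct.
So §8–§9 CONSTRAIN the line (no member `F c`, `c ≠ 0`, may be time-symmetric; bounded-mass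
shields must recede — they do, at radius `~ m(R(c))/μ → ∞`) but do not kill it. -/

end Summit.FinalStateConjecture.FinalStateConjecture.Cruxes.ParametricKerrBurial.Disproof

end
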